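import Literature.Probability.RandomPlanarGeometry.HexSAWSurfaceWallRenewalSixStep
import Literature.Probability.RandomPlanarGeometry.HexSAWSurfaceWallRenewalExcessLimit
import Literature.Probability.RandomPlanarGeometry.HexSAWSurfaceWallRenewalTenThree
import HarnessLib

/-!
# Rigidity of the six-step law: the equality case `6 · v = n` and the census `N_{3k,k} = 1`

For the self-avoiding walk on the honeycomb lattice (brick-wall frame) in the half-plane `Y ≤ 0`, the six-step law
`six_mul_visits_le` of `HexSAWSurfaceWallRenewalSixStep` bounds the surface visits of an IRREDUCIBLE POSITIVE WALL BRIDGE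
(`ipwb n`: a positive wall bridge with no wall-renewal time in `[1, n)`; `n ≥ 4`) by `6 · visits n ω ≤ n`.  This module
decides its EQUALITY CASE and counts it:

* `eq_hook_of_six_mul_visits_eq : ω ∈ ipwb n → 4 ≤ n → 6 * visits n ω = n → (n = 6 ∧ ω = Six.dw) ∨ ∃ k, 2 ≤ k ∧ n = 6 * k ∧ ω = hook k`
  — equality holds only for the dip excursion (`n = 6`) and the HOOK STAIRCASES `hook k` (`n = 6k`, `k ≥ 2`; tables `hookTabX`,
  `hookTabY`, `hook k = Tab.walk (6 k) (hookTabX k) (hookTabY k)`):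
  `(0,0) → … → (2k−1,0) ↓ (2k−1,−1) ← … ← (2,−1) ↓ (2,−2) → … → (2k,−2) ↑ (2k,−1) → (2k+1,−1) ↑ (2k+1,0) → (2k+2,0)`;
* `hook_mem_ipwb`, `visits_hook` — conversely every hook staircase is an irreducible positive wall bridge of length `6k` with `k`
  visits, so the law is attained at every length `6k` (`six_mul_visits_eq_iff`);
* `filter_six_mul_visits_eq_singleton_hook`, `filter_six_mul_visits_eq_singleton_dw`, `card_filter_six_mul_visits_eq` — the
  census of the equality case: `#{ω ∈ ipwb n : 6 · visits n ω = n} = [6 ∣ n]` for every `n ≥ 1`; in the notation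
  `N_{s,v} := #{ω ∈ ipwb (2s) : visits = v}` of the irreducible two-variable census, `N_{3k,k} = 1` for every `k ≥ 1` (the top
  non-empty diagonal `s = 3v` carries exactly one block per order);
* §1 the SLACK FORM of the six-step law (the bookkeeping of `six_mul_visits_le` with the slack retained; `X_n = ω n 0`, `v = visits`):
  `2v + 2 ≤ X_n`, `X_n + 4v ≤ n + 2`, `X_n + #down + 4v ≤ n + 4`, `#down + 6v ≤ n + 2`, `#up = #down` (`eq_case_counts`:
  equality forces `3 X_n = n + 6` and `1 ≤ #down = #up ≤ 2`).

Proof.  Between vertical steps the walk moves along a row and, by self-avoidance, each such HORIZONTAL RUN is monotone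
(`run_affine`); the height at time `t` is `#{up steps < t} − #{down steps < t}` (`apply_one_eq_card_sub`).  ONE down step (§3,
`eq_six_of_card_stepsD_eq_one`): the three runs go right (a leftward run on row `−1` would re-enter the initial wall run, a leftward
final run would end left of an earlier column), so `X_n = n − 2` and `3 X_n = n + 6` gives `n = 6`, where `ipwb 6 = {dip}`
(`ipwb_six_eq_singleton`).  TWO down steps at times `p < q`, up steps at `r < s` (§5, `profile_two`): the profile `D U D U` has a
wall-renewal time right after its first return to the wall (`dudu_false`); in the profile `D D U U` one has `v = p/2 + (n − s)/2` and
`X_s = p + 2`, the runs on rows `−1`, `−2` have forced directions, and `6v = n` pins `q + 1 = 2p`, `r + 1 = 3p`, `s = r + 2`,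
`n = s + 2`, i.e. the hook with `2k = p + 1` (`dduu_hook`, table identification `hook_table`); a leftward third run makes the final
run cross the column of the third run's start at a time `τ ≤ n` which is a wall-renewal time if `τ < n`, while `τ = n` forces an odd
column under the second down step or a wall-renewal time at `2` (`dduu_left_false`).  The hook facts (§6, `hook_facts`) are checked on
the seven affine pieces of the tables (`hook_cases`); irreducibility (`hook_mem_ipwb`): an interior visit time `t ≤ 2k − 2` is not a
renewal time because the walk is back at column `2 ≤ t` at time `4k − 3 > t`.

OURS: the classification and the census value prove the lane conjecture «`6·visits = n` iff `n = 6k` and `ω = H_k`»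
(FINDING-HEX-WALL-SIX-STEP-LAW §3, data `k ≤ 5`).  The printed sources carry the renewal / irreducible-bridge structure
(Madras–Slade §4.2 and Definition 1.2.4; Kesten), the brickwork frame of the honeycomb lattice (Enting–Jensen Fig. 7.10) and the
surface-visit statistic (Beaton et al. §3.1) — none states this classification; the model is Madras–Slade's remark that an
irreducible bridge of span `L` has at least `3L` steps (§4.2, p. 94).  No `set_option maxHeartbeats` budget line is used.
-/
namespace Literature.Probability.RandomPlanarGeometry.SAW.HexBW.Wall

open Finset Filter Function
open Literature.Probability.LatticeModels Literature.Probability.Percolation SimpleGraph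

variable {n : ℕ} {ω : ℕ → Site 2}

/-- [folklore] Two coordinates determine a site of `ℤ²`. -/
private theorem site_ext_rig {p q : Site 2} (h0 : p 0 = q 0) (h1 : p 1 = q 1) : p = q := by
  funext k
  fin_cases k
  · exact h0
  · exact h1

/-! ### §1 The slack form of the six-step law -/

/-- The bookkeeping behind the six-step law with its slacks kept: the gap count `2v + 2 ≤ X_n`, the charge count
`X_n + 4v ≤ n + 2`, the down-step count `X_n + #down + 4v ≤ n + 4`, and `#up = #down`.
[cite: MadrasSlade1993, §4.2, remark before (4.2.21) (p. 94: an irreducible bridge of span L has at least 3L steps)] -/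
private theorem six_step_slack (hω : ω ∈ ipwb n) (hn : 4 ≤ n) :
    2 * (visits n ω : ℤ) + 2 ≤ ω n 0 ∧ ω n 0 + 4 * (visits n ω : ℤ) ≤ n + 2 ∧
      ω n 0 + #(stepsD n ω) + 4 * (visits n ω : ℤ) ≤ n + 4 ∧ #(stepsU n ω) = #(stepsD n ω) := by
  classical
  obtain ⟨hp, hn1, hirr⟩ := mem_ipwb.1 hω
  obtain ⟨hw, hb⟩ := mem_pwb.1 hp
  obtain ⟨ha, -⟩ := mem_wbr.1 hw
  obtain ⟨hh, hn2, hYn⟩ := mem_archs.1 ha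
  obtain ⟨hs, hhp⟩ := mem_hpw.1 hh
  obtain ⟨h0, hend, hbw, hinj⟩ := mem_saws_iff.1 hs
  have hX0 : ω 0 0 = 0 := by rw [h0]; rfl
  have hY0 : ω 0 1 = 0 := by rw [h0]; rfl
  obtain ⟨hcnt, hX, hY⟩ := steps_count hbw
  rw [hX0, sub_zero] at hX
  rw [hY0, hYn, sub_zero] at hY
  obtain ⟨m, hm2, hmL, hme, hmW⟩ := exists_gap hω hn
  have hD1 := one_le_card_stepsD hω hn
  set R := stepsR n ω
  set L := stepsL n ω
  set U := stepsU n ω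
  set D := stepsD n ω
  set W := wallTimes n ω with hWdef
  have hmemW : ∀ {t}, t ∈ W ↔ (1 ≤ t ∧ t ≤ n) ∧ t % 2 = 0 ∧ ω t 1 = 0 := fun {t} => by
    rw [hWdef, wallTimes, Finset.mem_filter, Finset.mem_Icc]
  have hWinj : ∀ {t t'}, t ∈ W → t' ∈ W → ω t 0 = ω t' 0 → t = t' := fun {t t'} ht ht' he => by
    obtain ⟨⟨-, htn⟩, -, hy⟩ := hmemW.1 ht
    obtain ⟨⟨-, htn'⟩, -, hy'⟩ := hmemW.1 ht'
    exact hinj (show t ∈ {i | i ≤ n} from htn) (show t' ∈ {i | i ≤ n} from htn') (site_ext_rig he (by rw [hy, hy']))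
  have hWeven : ∀ {t}, t ∈ W → ω t 0 % 2 = 0 ∧ 0 < ω t 0 ∧ ω t 0 ≤ ω n 0 := fun {t} ht => by
    obtain ⟨⟨ht1, htn⟩, ht2, hy⟩ := hmemW.1 ht
    have hpar := parity_apply hs htn
    rw [hy, add_zero] at hpar
    have hbt := hb t ht1 htn
    rw [hX0] at hbt
    exact ⟨by omega, hbt.1, hbt.2⟩
  -- (1) abscissa count with the gap `m`: `2 · #W + 2 ≤ X_n`
  have hA : 2 * (#W : ℤ) + 2 ≤ ω n 0 := by
    have hmem : m / 2 ∈ Finset.Icc (1 : ℤ) (ω n 0 / 2) := by rw [Finset.mem_Icc]; constructor <;> omega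
    have h1 : #W ≤ #((Finset.Icc (1 : ℤ) (ω n 0 / 2)).erase (m / 2)) := by
      refine Finset.card_le_card_of_injOn (fun t => ω t 0 / 2) (fun t ht => ?_) (fun t ht t' ht' he => ?_)
      · have ht0 := Finset.mem_coe.1 ht
        obtain ⟨he, hpos, hle⟩ := hWeven ht0
        rw [Finset.mem_coe, Finset.mem_erase, Finset.mem_Icc]
        show ω t 0 / 2 ≠ m / 2 ∧ 1 ≤ ω t 0 / 2 ∧ ω t 0 / 2 ≤ ω n 0 / 2
        exact ⟨fun h => hmW t ht0 (by omega), by omega, by omega⟩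
      · obtain ⟨he1, -, -⟩ := hWeven (Finset.mem_coe.1 ht)
        obtain ⟨he2, -, -⟩ := hWeven (Finset.mem_coe.1 ht')
        exact hWinj (Finset.mem_coe.1 ht) (Finset.mem_coe.1 ht') (by dsimp only at he; omega)
    rw [Finset.card_erase_of_mem hmem, Int.card_Icc] at h1
    have h3 := Int.toNat_of_nonneg (show (0 : ℤ) ≤ ω n 0 / 2 + 1 - 1 by omega)
    omega
  -- interior visit times
  have hnW : n ∈ W := hmemW.2 ⟨⟨hn1, le_rfl⟩, hn2, hYn⟩
  set W' := W.erase n with hW'def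
  have hWW' : #W = #W' + 1 := (Finset.card_erase_add_one hnW).symm
  have hmemW' : ∀ {t}, t ∈ W' → 1 ≤ t ∧ t < n ∧ t % 2 = 0 ∧ ω t 1 = 0 ∧ t ∈ W := fun {t} ht => by
    obtain ⟨hne, htW⟩ := Finset.mem_erase.1 ht
    obtain ⟨⟨ht1, htn⟩, ht2, hy⟩ := hmemW.1 htW
    exact ⟨ht1, lt_of_le_of_ne htn hne, ht2, hy, htW⟩
  set E := W'.filter fun t => NearRenewal n ω t with hEdef
  have hEW' : E ⊆ W' := Finset.filter_subset _ _
  have hsd : #(W' \ E) + #E = #W' := Finset.card_sdiff_add_card_eq_card hEW'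
  set Lod := L.filter fun i => ¬ ω (i + 1) 0 % 2 = 0 with hLod
  set Lev := L.filter fun i => ω (i + 1) 0 % 2 = 0 with hLev
  have hLsplit : #Lev + #Lod = #L := Finset.card_filter_add_card_filter_not _
  have hmemL : ∀ {i}, i ∈ L ↔ i < n ∧ ω (i + 1) 0 = ω i 0 - 1 := fun {i} => by
    show i ∈ stepsL n ω ↔ _; rw [stepsL, Finset.mem_filter, Finset.mem_range]
  -- (2a) every interior visit owns a left step landing on its own (even) column
  have hBev : #W' ≤ #Lev := by
    have hex : ∀ t ∈ W', ∃ i, i < n ∧ ω (i + 1) 0 = ω i 0 - 1 ∧ ω (i + 1) 0 = ω t 0 := fun t ht => by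
      obtain ⟨ht1, htn, ht2, hy, -⟩ := hmemW' ht
      obtain ⟨⟨h1 | h1, -⟩, ⟨h0', -⟩, hne⟩ := wall_steps_horizontal hp ht1 htn ht2 hy
      · exact exists_left_step_onto hω ht1 htn ht2 hy h1
      · refine ⟨t - 1, by omega, ?_, ?_⟩
        · rw [show t - 1 + 1 = t by omega]; omega
        · rw [show t - 1 + 1 = t by omega]
    let φ : ℕ → ℕ := fun t => if h : t ∈ W' then Classical.choose (hex t h) else 0
    have hφ : ∀ t (h : t ∈ W'), φ t < n ∧ ω (φ t + 1) 0 = ω (φ t) 0 - 1 ∧ ω (φ t + 1) 0 = ω t 0 := fun t h => by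
      simp only [φ, dif_pos h]; exact Classical.choose_spec (hex t h)
    refine Finset.card_le_card_of_injOn φ (fun t ht => ?_) (fun t ht t' ht' he => ?_)
    · have ht' := Finset.mem_coe.1 ht
      obtain ⟨h1, h2, h3⟩ := hφ t ht'
      have htW := (hmemW' ht').2.2.2.2
      rw [Finset.mem_coe, hLev, Finset.mem_filter, hmemL]
      exact ⟨⟨h1, h2⟩, by rw [h3]; exact (hWeven htW).1⟩
    · have h1 := Finset.mem_coe.1 ht
      have h2 := Finset.mem_coe.1 ht'
      obtain ⟨-, -, e1⟩ := hφ t h1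
      obtain ⟨-, -, e2⟩ := hφ t' h2
      exact hWinj (hmemW' h1).2.2.2.2 (hmemW' h2).2.2.2.2 (by rw [← e1, ← e2, he])
  -- (2b) every interior visit that is not a near-renewal owns a left step landing on the odd column `X_t − 1`
  have hBod : #(W' \ E) ≤ #Lod := by
    have hex : ∀ t ∈ W' \ E, ∃ i, i < n ∧ ω (i + 1) 0 = ω i 0 - 1 ∧ ω (i + 1) 0 = ω t 0 - 1 := fun t ht => by
      rw [Finset.mem_sdiff] at ht
      obtain ⟨ht', htE⟩ := ht
      obtain ⟨ht1, htn, ht2, hy, -⟩ := hmemW' ht'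
      rcases exists_left_step_onto_pred hω ht1 htn ht2 hy with h | h
      · exact h
      · exact absurd (show t ∈ E by rw [hEdef, Finset.mem_filter]; exact ⟨ht', h⟩) htE
    let ψ : ℕ → ℕ := fun t => if h : t ∈ W' \ E then Classical.choose (hex t h) else 0
    have hψ : ∀ t (h : t ∈ W' \ E), ψ t < n ∧ ω (ψ t + 1) 0 = ω (ψ t) 0 - 1 ∧ ω (ψ t + 1) 0 = ω t 0 - 1 :=
      fun t h => by simp only [ψ, dif_pos h]; exact Classical.choose_spec (hex t h)
    have hW'of : ∀ {t}, t ∈ W' \ E → t ∈ W := fun {t} ht => (hmemW' (Finset.mem_sdiff.1 ht).1).2.2.2.2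
    refine Finset.card_le_card_of_injOn ψ (fun t ht => ?_) (fun t ht t' ht' he => ?_)
    · have ht' := Finset.mem_coe.1 ht
      obtain ⟨h1, h2, h3⟩ := hψ t ht'
      have hev := (hWeven (hW'of ht')).1
      rw [Finset.mem_coe, hLod, Finset.mem_filter, hmemL]
      exact ⟨⟨h1, h2⟩, by rw [h3]; omega⟩
    · have h1 := Finset.mem_coe.1 ht
      have h2 := Finset.mem_coe.1 ht'
      obtain ⟨-, -, e1⟩ := hψ t h1
      obtain ⟨-, -, e2⟩ := hψ t' h2
      exact hWinj (hW'of h1) (hW'of h2) (by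
        have : ω t 0 - 1 = ω t' 0 - 1 := by rw [← e1, ← e2, he]
        omega)
  -- (3) down steps owned by the near-renewals
  have hDE : 2 * #E ≤ #D := two_mul_card_nearRenewal_le_card_stepsD hω (T := E) fun t ht => by
    rw [hEdef, Finset.mem_filter] at ht
    obtain ⟨ht', hnr⟩ := ht
    obtain ⟨-, htn, -, -, htW⟩ := hmemW' ht'
    exact ⟨htW, htn, hnr⟩
  -- conclusion
  rw [visits_eq_card]
  show 2 * ((#W : ℕ) : ℤ) + 2 ≤ ω n 0 ∧ ω n 0 + 4 * ((#W : ℕ) : ℤ) ≤ n + 2 ∧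
    ω n 0 + #D + 4 * ((#W : ℕ) : ℤ) ≤ n + 4 ∧ #U = #D
  have hcnt' : ((#R + #L + #U + #D : ℕ) : ℤ) = n := by exact_mod_cast hcnt
  push_cast at hcnt'
  refine ⟨hA, by omega, by omega, by omega⟩

/-- **Gap count**: an irreducible positive wall bridge of length `n ≥ 4` with `v` visits has span `X_n ≥ 2v + 2`
(the visits sit on distinct even columns of `(0, X_n]`, and one even column is missed, `exists_gap`).
[cite: MadrasSlade1993, §4.2, remark before (4.2.21) (p. 94)] -/
theorem two_mul_visits_add_two_le_apply (hω : ω ∈ ipwb n) (hn : 4 ≤ n) : 2 * (visits n ω : ℤ) + 2 ≤ ω n 0 :=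
  (six_step_slack hω hn).1

/-- **Charge count**: `X_n + 4v ≤ n + 2` for an irreducible positive wall bridge of length `n ≥ 4` (two left steps
per interior visit, paid back by the down steps of the near-renewals). With the gap count this is the six-step law
`6v ≤ n`; equality in the law forces `X_n = 2v + 2`. [cite: MadrasSlade1993, §4.2, remark before (4.2.21) (p. 94)] -/
theorem apply_add_four_mul_visits_le (hω : ω ∈ ipwb n) (hn : 4 ≤ n) : ω n 0 + 4 * (visits n ω : ℤ) ≤ n + 2 :=
  (six_step_slack hω hn).2.1

/-- **Down-step count**: `X_n + #down + 4v ≤ n + 4`; with the gap count, `#down + 6v ≤ n + 2` — an irreducible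
positive wall bridge with `6v = n` has at most two down steps. [cite: MadrasSlade1993, §4.2, remark before (4.2.21) (p. 94)] -/
theorem apply_add_card_stepsD_add_four_mul_visits_le (hω : ω ∈ ipwb n) (hn : 4 ≤ n) :
    ω n 0 + #(stepsD n ω) + 4 * (visits n ω : ℤ) ≤ n + 4 :=
  (six_step_slack hω hn).2.2.1

/-- `#down + 6v ≤ n + 2`. [cite: MadrasSlade1993, §4.2, remark before (4.2.21) (p. 94)] -/
theorem card_stepsD_add_six_mul_visits_le (hω : ω ∈ ipwb n) (hn : 4 ≤ n) :
    #(stepsD n ω) + 6 * visits n ω ≤ n + 2 := by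
  obtain ⟨h1, -, h3, -⟩ := six_step_slack hω hn
  omega

/-- `#up = #down` for a positive wall bridge piece (`Y_0 = Y_n = 0`). [cite: MadrasSlade1993, §1.2] -/
theorem card_stepsU_eq_card_stepsD (hω : ω ∈ ipwb n) (hn : 4 ≤ n) : #(stepsU n ω) = #(stepsD n ω) :=
  (six_step_slack hω hn).2.2.2

/-- **The equality case, numerically**: `6v = n` forces `X_n = 2v + 2 = n/3 + 2`, `#down = #up ≤ 2`.
[cite: MadrasSlade1993, §4.2, remark before (4.2.21) (p. 94)] -/
theorem eq_case_counts (hω : ω ∈ ipwb n) (hn : 4 ≤ n) (h6 : 6 * visits n ω = n) :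
    3 * ω n 0 = n + 6 ∧ #(stepsD n ω) ≤ 2 ∧ 1 ≤ #(stepsD n ω) ∧ #(stepsU n ω) = #(stepsD n ω) := by
  obtain ⟨h1, h2, h3, h4⟩ := six_step_slack hω hn
  have hD1 := one_le_card_stepsD hω hn
  refine ⟨by omega, by omega, hD1, h4⟩

/-! ### §2 Profile machinery: horizontal runs are monotone, heights from the vertical-step counts -/

/-- A step which is neither up nor down is horizontal. [cite: EntingJensen2009, §7.4.2, Fig. 7.10 (brickwork form of the honeycomb lattice)] -/
private theorem horizontal_of_not_mem (hbw : IsBW n ω) {i : ℕ} (hi : i < n) (hU : i ∉ stepsU n ω)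
    (hD : i ∉ stepsD n ω) : ω (i + 1) 1 = ω i 1 ∧ (ω (i + 1) 0 = ω i 0 + 1 ∨ ω (i + 1) 0 = ω i 0 - 1) := by
  have h := step_cases hbw hi
  simp only [stepsU, stepsD, Finset.mem_filter, Finset.mem_range, not_and] at hU hD
  have hU' := hU hi
  have hD' := hD hi
  omega

/-- The parity constraint of an up step: it starts at a site `(a, b)` with `a + b` even.
[cite: EntingJensen2009, §7.4.2, Fig. 7.10] -/
private theorem of_mem_stepsU (hbw : IsBW n ω) {i : ℕ} (hi : i ∈ stepsU n ω) :
    i < n ∧ ω (i + 1) 0 = ω i 0 ∧ ω (i + 1) 1 = ω i 1 + 1 ∧ (ω i 0 + ω i 1) % 2 = 0 := by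
  simp only [stepsU, Finset.mem_filter, Finset.mem_range] at hi
  obtain ⟨hin, hx, hy⟩ := hi
  have h := (brickWallGraph_adj_coord _ _).1 (hbw i hin)
  exact ⟨hin, hx, hy, by omega⟩

/-- The parity constraint of a down step: it ends at a site `(a, b)` with `a + b` even.
[cite: EntingJensen2009, §7.4.2, Fig. 7.10] -/
private theorem of_mem_stepsD (hbw : IsBW n ω) {i : ℕ} (hi : i ∈ stepsD n ω) :
    i < n ∧ ω (i + 1) 0 = ω i 0 ∧ ω (i + 1) 1 = ω i 1 - 1 ∧ (ω (i + 1) 0 + ω (i + 1) 1) % 2 = 0 := by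
  simp only [stepsD, Finset.mem_filter, Finset.mem_range] at hi
  obtain ⟨hin, hx, hy⟩ := hi
  have h := (brickWallGraph_adj_coord _ _).1 (hbw i hin)
  exact ⟨hin, hx, hy, by omega⟩

/-- **Horizontal runs are monotone**: on a time interval `[a, b]` without vertical steps a self-avoiding walk moves
with constant velocity `e = ±1` along its row. [cite: MadrasSlade1993, §1.2] -/
private theorem run_affine (hinj : Set.InjOn ω {i | i ≤ n}) {a b : ℕ} (hab : a ≤ b) (hbn : b ≤ n)
    (hh : ∀ i, a ≤ i → i < b → ω (i + 1) 1 = ω i 1 ∧ (ω (i + 1) 0 = ω i 0 + 1 ∨ ω (i + 1) 0 = ω i 0 - 1)) :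
    ∃ e : ℤ, (e = 1 ∨ e = -1) ∧ ∀ i, a ≤ i → i ≤ b → ω i 0 = ω a 0 + e * ((i - a : ℕ) : ℤ) ∧ ω i 1 = ω a 1 := by
  rcases Nat.lt_or_ge a b with hlt | hge
  swap
  · refine ⟨1, Or.inl rfl, fun i h1 h2 => ?_⟩
    obtain rfl : i = a := le_antisymm (h2.trans hge) h1
    simp
  obtain ⟨hy0, hx0⟩ := hh a le_rfl hlt
  -- the velocity of the first step
  obtain ⟨e, he, hx0'⟩ : ∃ e : ℤ, (e = 1 ∨ e = -1) ∧ ω (a + 1) 0 = ω a 0 + e := by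
    rcases hx0 with h | h
    · exact ⟨1, Or.inl rfl, h⟩
    · exact ⟨-1, Or.inr rfl, by omega⟩
  refine ⟨e, he, ?_⟩
  -- two consecutive values at a time, by induction on the offset
  have key : ∀ d, a + d + 1 ≤ b →
      (ω (a + d) 0 = ω a 0 + e * (d : ℤ) ∧ ω (a + d) 1 = ω a 1) ∧
        (ω (a + d + 1) 0 = ω a 0 + e * ((d : ℤ) + 1) ∧ ω (a + d + 1) 1 = ω a 1) := by
    intro d
    induction d with
    | zero =>
      intro _
      refine ⟨⟨by simp, by simp⟩, by simpa using hx0', by simpa using hy0⟩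
    | succ d ih =>
      intro hd
      obtain ⟨⟨hx1, hy1⟩, hx2, hy2⟩ := ih (by omega)
      refine ⟨⟨by rw [show a + (d + 1) = a + d + 1 by omega, hx2]; push_cast; ring, by
        rw [show a + (d + 1) = a + d + 1 by omega, hy2]⟩, ?_⟩
      obtain ⟨hy3, hx3⟩ := hh (a + d + 1) (by omega) (by omega)
      rw [show a + (d + 1) + 1 = a + d + 1 + 1 by omega]
      refine ⟨?_, by rw [hy3, hy2]⟩
      -- a reversal would revisit `ω (a + d)`
      by_contra hne
      have hback : ω (a + d + 1 + 1) 0 = ω (a + d) 0 := by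
        rcases he with rfl | rfl <;> rcases hx3 with h | h <;> omega
      have := hinj (show a + d + 1 + 1 ∈ {i | i ≤ n} by simp; omega) (show a + d ∈ {i | i ≤ n} by simp; omega)
        (site_ext_rig hback (by rw [hy3, hy2, hy1]))
      omega
  intro i h1 h2
  rcases Nat.lt_or_ge i b with hib | hib
  · obtain ⟨⟨hx, hy⟩, -⟩ := key (i - a) (by omega)
    rw [show a + (i - a) = i by omega] at hx hy
    exact ⟨hx, hy⟩
  · obtain rfl : i = b := le_antisymm h2 hib
    obtain ⟨-, hx, hy⟩ := key (i - a - 1) (by omega)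
    rw [show a + (i - a - 1) + 1 = i by omega] at hx hy
    refine ⟨?_, hy⟩
    rw [hx, show ((i - a : ℕ) : ℤ) = ((i - a - 1 : ℕ) : ℤ) + 1 by omega]

/-- The height at time `t` is the number of up steps minus the number of down steps before `t`.
[cite: MadrasSlade1993, §1.2 (coordinates of a walk as sums of steps)] -/
private theorem apply_one_eq_card_sub (hbw : IsBW n ω) (hY0 : ω 0 1 = 0) {t : ℕ} (ht : t ≤ n) :
    ω t 1 = #((stepsU n ω).filter (· < t)) - #((stepsD n ω).filter (· < t)) := by
  have hbw' : IsBW t ω := fun i hi => hbw i (by omega)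
  obtain ⟨-, -, hY⟩ := steps_count hbw'
  rw [hY0, sub_zero] at hY
  have hU : stepsU t ω = (stepsU n ω).filter (· < t) := by
    ext i
    simp only [stepsU, Finset.mem_filter, Finset.mem_range]
    constructor
    · rintro ⟨h1, h2⟩; exact ⟨⟨by omega, h2⟩, h1⟩
    · rintro ⟨⟨-, h2⟩, h3⟩; exact ⟨h3, h2⟩
  have hD : stepsD t ω = (stepsD n ω).filter (· < t) := by
    ext i
    simp only [stepsD, Finset.mem_filter, Finset.mem_range]
    constructor
    · rintro ⟨h1, h2⟩; exact ⟨⟨by omega, h2⟩, h1⟩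
    · rintro ⟨⟨-, h2⟩, h3⟩; exact ⟨h3, h2⟩
  rw [← hU, ← hD]
  exact hY

/-- Counting a singleton below a threshold. [folklore] -/
private theorem card_filter_singleton_lt (x t : ℕ) :
    (#(({x} : Finset ℕ).filter (· < t)) : ℤ) = if x < t then 1 else 0 := by
  rw [Finset.filter_singleton]
  split_ifs <;> simp

/-- Counting a pair below a threshold. [folklore] -/
private theorem card_filter_pair_lt {x y : ℕ} (hxy : x ≠ y) (t : ℕ) :
    (#(({x, y} : Finset ℕ).filter (· < t)) : ℤ) = (if x < t then 1 else 0) + (if y < t then 1 else 0) := by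
  rw [Finset.filter_insert, Finset.filter_singleton]
  split_ifs <;> simp [Finset.card_insert_of_notMem, hxy]

/-- A wall-renewal time from the profile data: `t` even on the wall, no earlier column beyond `X_t`, every later
column beyond it. [cite: MadrasSlade1993, §4.2, Definition 4.2.1] -/
private theorem isWRen_of (hb : ∀ i, 1 ≤ i → i ≤ n → ω 0 0 < ω i 0 ∧ ω i 0 ≤ ω n 0) {t : ℕ} (htn : t ≤ n)
    (ht2 : t % 2 = 0) (hY : ω t 1 = 0) (hhead : ∀ i, 1 ≤ i → i ≤ t → ω i 0 ≤ ω t 0)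
    (htail : ∀ j, t < j → j ≤ n → ω t 0 < ω j 0) : IsWRen n ω t := by
  refine ⟨⟨htn, fun i h1 h2 => ⟨(hb i h1 (h2.trans htn)).1, hhead i h1 h2⟩, fun j h1 h2 => ⟨?_, ?_⟩⟩, ht2, hY⟩
  · simpa only [Nat.add_zero] using htail (t + j) (by omega) (by omega)
  · have := (hb (t + j) (by omega) (by omega)).2
    show ω (t + j) 0 ≤ ω (t + (n - t)) 0
    rwa [show t + (n - t) = n by omega]

/-- On a stretch along the wall the visits are the even times: `visits m = ⌊m/2⌋`.
[cite: BeatonBousquetMelouDeGierDuminilCopinGuttmann2014, §3.1 (arXiv v5 p. 8)] -/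
private theorem visits_eq_div_two {m : ℕ} {ξ : ℕ → Site 2} (h : ∀ i, 1 ≤ i → i ≤ m → ξ i 1 = 0) :
    visits m ξ = m / 2 := by
  induction m with
  | zero => simp
  | succ m ih =>
    rw [visits_succ, ih (fun i h1 h2 => h i h1 (by omega)), h (m + 1) (by omega) le_rfl]
    split_ifs with hc <;> omega

/-- The first step of a positive wall bridge is the wall step `(0,0) → (1,0)`. [cite: MadrasSlade1993, Definition 1.2.4] -/
private theorem first_step (hbw : IsBW n ω) (hn : 1 ≤ n) (hX0 : ω 0 0 = 0) (hY0 : ω 0 1 = 0)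
    (hb : ∀ i, 1 ≤ i → i ≤ n → ω 0 0 < ω i 0 ∧ ω i 0 ≤ ω n 0) : ω 1 0 = 1 ∧ ω 1 1 = 0 := by
  have h := step_cases hbw (show 0 < n by omega)
  simp only [Nat.zero_add] at h
  have h1 := (hb 1 le_rfl hn).1
  omega

/-! ### §3 The three profiles of a block with at most two down steps -/

/-- **Profile `D U`** (`#down = #up = 1`): the three horizontal runs all go right (a left run on row `−1` would climb
back onto the initial wall run, a left final run would end left of an earlier column), so `X_n = n − 2`; with the
equality-case count `3·X_n = n + 6` the length is `6`. [cite: MadrasSlade1993, §4.2, Definition 4.2.1] -/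
private theorem eq_six_of_card_stepsD_eq_one (hω : ω ∈ ipwb n) (h3 : 3 * ω n 0 = n + 6)
    (hD : #(stepsD n ω) = 1) (hU : #(stepsU n ω) = 1) : n = 6 := by
  classical
  obtain ⟨hp, hn1, -⟩ := mem_ipwb.1 hω
  obtain ⟨hw, hb⟩ := mem_pwb.1 hp
  obtain ⟨ha, -⟩ := mem_wbr.1 hw
  obtain ⟨hh, -, -⟩ := mem_archs.1 ha
  obtain ⟨hs, hhp⟩ := mem_hpw.1 hh
  obtain ⟨h0, -, hbw, hinj⟩ := mem_saws_iff.1 hs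
  have hX0 : ω 0 0 = 0 := by rw [h0]; rfl
  have hY0 : ω 0 1 = 0 := by rw [h0]; rfl
  have hb' : ∀ i, 1 ≤ i → i ≤ n → 0 < ω i 0 ∧ ω i 0 ≤ ω n 0 := fun i h1 h2 => by
    have := hb i h1 h2; rwa [hX0] at this
  obtain ⟨p, hDp⟩ := Finset.card_eq_one.1 hD
  obtain ⟨r, hUr⟩ := Finset.card_eq_one.1 hU
  obtain ⟨hpn, hpx, hpy, -⟩ := of_mem_stepsD hbw (show p ∈ stepsD n ω by rw [hDp]; exact Finset.mem_singleton_self _)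
  obtain ⟨hrn, hrx, hry, -⟩ := of_mem_stepsU hbw (show r ∈ stepsU n ω by rw [hUr]; exact Finset.mem_singleton_self _)
  have hhor : ∀ i, i < n → i ≠ p → i ≠ r →
      ω (i + 1) 1 = ω i 1 ∧ (ω (i + 1) 0 = ω i 0 + 1 ∨ ω (i + 1) 0 = ω i 0 - 1) := fun i hi hip hir =>
    horizontal_of_not_mem hbw hi (by rw [hUr, Finset.mem_singleton]; exact hir)
      (by rw [hDp, Finset.mem_singleton]; exact hip)
  have hYt : ∀ t, t ≤ n → ω t 1 = (if r < t then 1 else 0) - (if p < t then 1 else 0) := fun t ht => by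
    rw [apply_one_eq_card_sub hbw hY0 ht, hUr, hDp, card_filter_singleton_lt, card_filter_singleton_lt]
  -- the down step comes first
  have hpr : p < r := by
    have h1 := hYt (r + 1) (by omega)
    have h2 := hhp (r + 1) (by omega)
    have hne : p ≠ r := fun h => by rw [h] at hpy; omega
    split_ifs at h1 <;> omega
  -- run 0: the wall run `(i, 0)`, `i ≤ p`
  have h10 := first_step hbw hn1 hX0 hY0 hb
  have hp1 : 1 ≤ p := by
    by_contra h
    obtain rfl : p = 0 := by omega
    norm_num at hpx
    have := (hb' 1 le_rfl hn1).1
    omega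
  obtain ⟨e0, he0, hrun0⟩ := run_affine hinj (a := 0) (b := p) (by omega) (by omega)
    (fun i h1 h2 => hhor i (by omega) (by omega) (by omega))
  have he0' : e0 = 1 := by
    have := (hrun0 1 (by omega) hp1).1
    rcases he0 with rfl | rfl <;> omega
  subst he0'
  have hYp : ω p 1 = 0 := by rw [(hrun0 p (by omega) le_rfl).2, hY0]
  -- run 1 on row `−1` from `(p, −1)`; it must go right, else the up step lands on the wall run
  obtain ⟨e1, he1, hrun1⟩ := run_affine hinj (a := p + 1) (b := r) (by omega) (by omega)
    (fun i h1 h2 => hhor i (by omega) (by omega) (by omega))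
  have hx : (p : ℤ) + 1 ≤ ω r 0 := by
    by_contra hlt
    have hr1 := (hb' r (by omega) (by omega)).1
    -- the wall site `(X_r, 0) = ω (r+1)` is the site of the wall run at time `X_r ≤ p`
    have hτ := hrun0 (ω r 0).toNat (by omega) (by omega)
    have := hinj (show r + 1 ∈ {i | i ≤ n} by simp; omega) (show (ω r 0).toNat ∈ {i | i ≤ n} by simp; omega)
      (site_ext_rig (by rw [hrx, hτ.1, hX0]; omega) (by rw [hry, (hrun1 r (by omega) le_rfl).2, hpy, hτ.2, hY0, hYp]; omega))
    omega
  have hxr : ω r 0 = (r : ℤ) - 1 := by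
    have := (hrun1 r (by omega) le_rfl).1
    rw [hpx, (hrun0 p (by omega) le_rfl).1, hX0] at this
    rcases he1 with rfl | rfl <;> omega
  -- run 2 on the wall from `(r − 1, 0)`: it goes right (the endpoint is the rightmost point)
  obtain ⟨e2, he2, hrun2⟩ := run_affine hinj (a := r + 1) (b := n) (by omega) le_rfl
    (fun i h1 h2 => hhor i (by omega) (by omega) (by omega))
  have hXn : ω n 0 = (n : ℤ) - 2 := by
    have h1 := (hrun2 n (by omega) le_rfl).1
    have h2 := (hb' (r + 1) (by omega) (by omega)).2
    rw [hrx] at h1 h2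
    rcases he2 with rfl | rfl <;> omega
  rw [hXn] at h3
  omega

/-! ### §4 The hook staircases `H_k` -/

/-- Column table of the hook staircase `H_k` (`k ≥ 2`, length `6k`): the wall run `(i,0)`, `i ≤ 2k−1`; the return run
`(4k−1−i, −1)`, `2k ≤ i ≤ 4k−3`, back to column `2`; the bottom run `(i+4−4k, −2)`, `4k−2 ≤ i ≤ 6k−4`, out to column `2k`;
the exit `(2k,−1)(2k+1,−1)(2k+1,0)(2k+2,0)`. [cite: EntingJensen2009, §7.4.2, Fig. 7.10 (brickwork form of the honeycomb lattice)] -/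
def hookTabX (k i : ℕ) : ℤ :=
  if i + 1 ≤ 2 * k then i
  else if i + 3 ≤ 4 * k then 4 * k - 1 - i
  else if i + 4 ≤ 6 * k then i + 4 - 4 * k
  else if i + 3 = 6 * k then 2 * k
  else if i + 1 ≤ 6 * k then 2 * k + 1
  else 2 * k + 2

/-- Height table of the hook staircase `H_k`. [cite: EntingJensen2009, §7.4.2, Fig. 7.10] -/
def hookTabY (k i : ℕ) : ℤ :=
  if i + 1 ≤ 2 * k then 0
  else if i + 3 ≤ 4 * k then -1
  else if i + 4 ≤ 6 * k then -2
  else if i + 2 ≤ 6 * k then -1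
  else 0

/-- **The hook staircase** `H_k = (0,0)(1,0)⋯(2k−1,0)(2k−1,−1)(2k−2,−1)⋯(2,−1)(2,−2)(3,−2)⋯(2k,−2)(2k,−1)(2k+1,−1)(2k+1,0)(2k+2,0)`
of length `6k` (`k ≥ 2`; `H_2` is the walk `Twelve.qw` of `HexSAWSurfaceWallRenewalCensusSix`, and the role of `H_1` is played by
the dip `Six.dw`). [cite: EntingJensen2009, §7.4.2, Fig. 7.10] -/
def hook (k : ℕ) : ℕ → Site 2 := Tab.walk (6 * k) (hookTabX k) (hookTabY k)

/-! ### §5 Profiles with two down steps: `D U D U` is impossible, `D D U U` is the hook or nothing -/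
/-- The site-by-site identification of the hook staircase from its run data. [cite: EntingJensen2009, §7.4.2, Fig. 7.10] -/
private theorem hook_table {p q r s k : ℕ} (hk : p + 1 = 2 * k) (hq : q + 1 = 2 * p) (hr : r + 1 = 3 * p)
    (hs : s = r + 2) (hn : n = s + 2) (hR0 : ∀ i, i ≤ p → ω i 0 = i ∧ ω i 1 = 0)
    (hrun1 : ∀ i, p + 1 ≤ i → i ≤ q → ω i 0 = 2 * (p : ℤ) + 1 - i ∧ ω i 1 = -1)
    (hrun2 : ∀ i, q + 1 ≤ i → i ≤ r → ω i 0 = (i : ℤ) + 2 - 2 * p ∧ ω i 1 = -2)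
    (hR1 : ω (r + 1) 0 = (p : ℤ) + 1 ∧ ω (r + 1) 1 = -1) (hS : ω s 0 = (p : ℤ) + 2 ∧ ω s 1 = -1)
    (hR4 : ∀ j, s + 1 ≤ j → j ≤ n → ω j 0 = (j : ℤ) + p + 1 - s ∧ ω j 1 = 0) :
    ∀ i, i ≤ n → ω i 0 = hookTabX k i ∧ ω i 1 = hookTabY k i := by
  intro i hi
  simp only [hookTabX, hookTabY]
  rcases Nat.lt_or_ge i (p + 1) with hi1 | hi1
  · obtain ⟨hx, hy⟩ := hR0 i (by omega); constructor <;> split_ifs <;> omega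
  rcases Nat.lt_or_ge i (q + 1) with hi2 | hi2
  · obtain ⟨hx, hy⟩ := hrun1 i hi1 (by omega); constructor <;> split_ifs <;> omega
  rcases Nat.lt_or_ge i (r + 1) with hi3 | hi3
  · obtain ⟨hx, hy⟩ := hrun2 i hi2 (by omega); constructor <;> split_ifs <;> omega
  rcases Nat.lt_or_ge i s with hi4 | hi4
  · obtain rfl : i = r + 1 := by omega
    obtain ⟨hx, hy⟩ := hR1; constructor <;> split_ifs <;> omega
  rcases Nat.lt_or_ge i (s + 1) with hi5 | hi5
  · obtain rfl : i = s := by omega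
    obtain ⟨hx, hy⟩ := hS; constructor <;> split_ifs <;> omega
  · obtain ⟨hx, hy⟩ := hR4 i hi5 hi; constructor <;> split_ifs <;> omega


/-- **Profile `D U D U` is impossible**: the three middle runs are forced rightward (a reversal would revisit the wall run,
run 1 or run 2), the final run stays to the right, and then the second wall site `(r, 0)` of the middle wall run, at the even
time `r + 2`, is a wall-renewal time. [cite: MadrasSlade1993, §4.2, Definition 4.2.1; EntingJensen2009, §7.4.2, Fig. 7.10] -/
private theorem dudu_false {p q r s : ℕ}
    (hinj : Set.InjOn ω {i | i ≤ n}) (hb : Zd.IsBridge n ω) (hb' : ∀ i, 1 ≤ i → i ≤ n → 0 < ω i 0 ∧ ω i 0 ≤ ω n 0)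
    (hirr : ∀ k, 1 ≤ k → k < n → ¬ IsWRen n ω k) (h6 : 6 * visits n ω = n) (h3 : 3 * ω n 0 = n + 6) (hn1 : 1 ≤ n)
    (hpq : p < q) (hrs : r < s) (hpr : p < r) (hqs : q < s) (hrq : r < q) (hpn : p < n) (hpx : ω (p + 1) 0 = ω p 0)
    (hpy : ω (p + 1) 1 = ω p 1 - 1) (hppar : (ω (p + 1) 0 + ω (p + 1) 1) % 2 = 0) (hqn : q < n)
    (hqx : ω (q + 1) 0 = ω q 0) (hqy : ω (q + 1) 1 = ω q 1 - 1) (hqpar : (ω (q + 1) 0 + ω (q + 1) 1) % 2 = 0)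
    (hrn : r < n) (hrx : ω (r + 1) 0 = ω r 0) (hry : ω (r + 1) 1 = ω r 1 + 1) (hrpar : (ω r 0 + ω r 1) % 2 = 0)
    (hsn : s < n) (hsx : ω (s + 1) 0 = ω s 0) (hsy : ω (s + 1) 1 = ω s 1 + 1) (hspar : (ω s 0 + ω s 1) % 2 = 0)
    (hhor : ∀ i, i < n → i ≠ p → i ≠ q → i ≠ r → i ≠ s →
      ω (i + 1) 1 = ω i 1 ∧ (ω (i + 1) 0 = ω i 0 + 1 ∨ ω (i + 1) 0 = ω i 0 - 1))
    (hR0 : ∀ i, i ≤ p → ω i 0 = i ∧ ω i 1 = 0) (hP1x : ω (p + 1) 0 = p) (hP1y : ω (p + 1) 1 = -1) (hpodd : p % 2 = 1) :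
    False := by
  classical
  have hmem : ∀ i, i ≤ n → i ∈ {i | i ≤ n} := fun i hi => hi
  obtain ⟨e1, he1, hrun1⟩ := run_affine hinj (a := p + 1) (b := r) (by omega) (by omega)
    (fun i h1 h2 => hhor i (by omega) (by omega) (by omega) (by omega) (by omega))
  have hx : (p : ℤ) + 1 ≤ ω r 0 := by
    by_contra hlt
    have hr1 := (hb' r (by omega) (by omega)).1
    have hτ := hR0 (ω r 0).toNat (by omega)
    have := hinj (hmem (r + 1) (by omega)) (hmem (ω r 0).toNat (by omega))
      (site_ext_rig (by rw [hrx, hτ.1]; omega) (by rw [hry, (hrun1 r (by omega) le_rfl).2, hP1y, hτ.2]; rfl))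
    omega
  obtain rfl : e1 = 1 := by
    rcases he1 with h | rfl
    · exact h
    exfalso; have := (hrun1 r (by omega) le_rfl).1; rw [hP1x] at this; omega
  have hR1x : ω (r + 1) 0 = r - 1 := by have := (hrun1 r (by omega) le_rfl).1; rw [hP1x] at this; rw [hrx]; omega
  have hR1y : ω (r + 1) 1 = 0 := by rw [hry, (hrun1 r (by omega) le_rfl).2, hP1y]; rfl
  have hrev : r % 2 = 0 := by
    have h1 := (hrun1 r (by omega) le_rfl).1; have h2 := (hrun1 r (by omega) le_rfl).2
    rw [hP1x] at h1; rw [hP1y] at h2; rw [h1, h2] at hrpar; omega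
  -- run 2 on the wall goes right (else the second down step lands on run 1, or the run crosses `ω p`)
  obtain ⟨e2, he2, hrun2⟩ := run_affine hinj (a := r + 1) (b := q) (by omega) (by omega)
    (fun i h1 h2 => hhor i (by omega) (by omega) (by omega) (by omega) (by omega))
  have hq2 : r + 2 ≤ q := by
    by_contra h
    obtain rfl : q = r + 1 := by omega
    have := hinj (hmem (r + 1 + 1) (by omega)) (hmem r (by omega))
      (site_ext_rig (by rw [hqx, hR1x, (hrun1 r (by omega) le_rfl).1, hP1x]; omega)
        (by rw [hqy, hR1y, (hrun1 r (by omega) le_rfl).2, hP1y]; rfl))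
    omega
  obtain rfl : e2 = 1 := by
    rcases he2 with h | rfl
    · exact h
    exfalso
    have hQx := (hrun2 q (by omega) le_rfl).1
    have hQy := (hrun2 q (by omega) le_rfl).2
    rw [hR1x] at hQx; rw [hR1y] at hQy
    by_cases hc : p + q ≤ 2 * r
    · -- the down step at `q` lands on run 1
      have h1 := hrun1 (2 * r - q + 1) (by omega) (by omega)
      rw [hP1x, hP1y] at h1
      have := hinj (hmem (q + 1) (by omega)) (hmem (2 * r - q + 1) (by omega))
        (site_ext_rig (by rw [hqx, hQx, h1.1]; omega) (by rw [hqy, hQy, h1.2]; rfl))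
      omega
    · -- run 2 walks over `ω p`
      have h1 := hrun2 (2 * r - p) (by omega) (by omega)
      rw [hR1x, hR1y] at h1
      have h2 := hR0 p le_rfl
      have := hinj (hmem (2 * r - p) (by omega)) (hmem p (by omega))
        (site_ext_rig (by rw [h1.1, h2.1]; omega) (by rw [h1.2, h2.2]))
      omega
  have hQ1x : ω (q + 1) 0 = q - 2 := by
    rw [hqx, (hrun2 q (by omega) le_rfl).1, hR1x]; omega
  have hQ1y : ω (q + 1) 1 = -1 := by rw [hqy, (hrun2 q (by omega) le_rfl).2, hR1y]; rfl
  have hq3 : r + 3 ≤ q := by rw [hQ1x, hQ1y] at hqpar; omega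
  -- run 3 on row `−1` goes right (else the last up step lands on run 2, or the run crosses `ω r`)
  obtain ⟨e3, he3, hrun3⟩ := run_affine hinj (a := q + 1) (b := s) (by omega) (by omega)
    (fun i h1 h2 => hhor i (by omega) (by omega) (by omega) (by omega) (by omega))
  have hs2 : q + 2 ≤ s := by
    by_contra h
    obtain rfl : s = q + 1 := by omega
    have := hinj (hmem (q + 1 + 1) (by omega)) (hmem q (by omega))
      (site_ext_rig (by rw [hsx, hQ1x, (hrun2 q (by omega) le_rfl).1, hR1x]; omega)
        (by rw [hsy, hQ1y, (hrun2 q (by omega) le_rfl).2, hR1y]; rfl))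
    omega
  obtain rfl : e3 = 1 := by
    rcases he3 with h | rfl
    · exact h
    exfalso
    have hSx := (hrun3 s (by omega) le_rfl).1
    have hSy := (hrun3 s (by omega) le_rfl).2
    rw [hQ1x] at hSx; rw [hQ1y] at hSy
    have hS1 := (hb' s (by omega) (by omega)).1
    by_cases hc : (r : ℤ) - 1 ≤ ω s 0
    · -- the up step at `s` lands on run 2
      have h1 := hrun2 (2 * q + 1 - s) (by omega) (by omega)
      rw [hR1x, hR1y] at h1
      have := hinj (hmem (s + 1) (by omega)) (hmem (2 * q + 1 - s) (by omega))
        (site_ext_rig (by rw [hsx, hSx, h1.1]; omega) (by rw [hsy, hSy, h1.2]; rfl))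
      omega
    · -- run 3 walks over `ω r`
      have h1 := hrun3 (2 * q - r) (by omega) (by omega)
      rw [hQ1x, hQ1y] at h1
      have h2 := hrun1 r (by omega) le_rfl
      rw [hP1x, hP1y] at h2
      have := hinj (hmem (2 * q - r) (by omega)) (hmem r (by omega))
        (site_ext_rig (by rw [h1.1, h2.1]; omega) (by rw [h1.2, h2.2]))
      omega
  have hS1x : ω (s + 1) 0 = s - 3 := by
    rw [hsx, (hrun3 s (by omega) le_rfl).1, hQ1x]; omega
  have hS1y : ω (s + 1) 1 = 0 := by rw [hsy, (hrun3 s (by omega) le_rfl).2, hQ1y]; rfl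
  -- run 4 on the wall stays right of column `s − 3`
  obtain ⟨e4, he4, hrun4⟩ := run_affine hinj (a := s + 1) (b := n) (by omega) le_rfl
    (fun i h1 h2 => hhor i (by omega) (by omega) (by omega) (by omega) (by omega))
  have hR4 : ∀ j, s + 1 ≤ j → j ≤ n → (s : ℤ) - 3 ≤ ω j 0 := by
    intro j h1 h2
    have hj := (hrun4 j h1 h2).1
    have hN := (hrun4 n (by omega) le_rfl).1
    have hbn := (hb' (s + 1) (by omega) (by omega)).2
    rw [hS1x] at hj hN hbn
    rcases he4 with rfl | rfl <;> omega
  -- the wall site `(r, 0)` at time `r + 2` is a wall-renewal time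
  have hXr2 : ω (r + 2) 0 = r := by
    have := (hrun2 (r + 2) (by omega) (by omega)).1; rw [hR1x] at this; rw [this]; omega
  refine hirr (r + 2) (by omega) (by omega) (isWRen_of hb (by omega) (by omega) ?_ ?_ ?_)
  · rw [(hrun2 (r + 2) (by omega) (by omega)).2, hR1y]
  · intro i h1 h2
    rw [hXr2]
    rcases Nat.lt_or_ge i (p + 1) with hi | hi
    · have := (hR0 i (by omega)).1; omega
    rcases Nat.lt_or_ge i (r + 1) with hi' | hi'
    · have := (hrun1 i hi (by omega)).1; rw [hP1x] at this; omega
    · have := (hrun2 i hi' (by omega)).1; rw [hR1x] at this; omega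
  · intro j h1 h2
    rw [hXr2]
    rcases Nat.lt_or_ge j (q + 1) with hj | hj
    · have := (hrun2 j (by omega) (by omega)).1; rw [hR1x] at this; omega
    rcases Nat.lt_or_ge j (s + 1) with hj' | hj'
    · have := (hrun3 j hj (by omega)).1; rw [hQ1x] at this; omega
    · have := hR4 j hj' h2; omega

/-- **Profile `D D U U`, run 3 rightward: the hook.**  With the last up step in column `p + 2` and run 3 moving right from
`(c, −1)`, the column `c` is `p + 1` (a smaller `c` puts `(c, −1)` on run 1, a one-step run 1 makes `c ≥ p + 2`); then no
wall-renewal at time `s + 2` forces `n = s + 2`, the count `6·v = n` forces `q = 2p − 1`, and the walk is `H_{(p+1)/2}` site by site.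
[cite: MadrasSlade1993, §4.2, Definition 4.2.1; EntingJensen2009, §7.4.2, Fig. 7.10] -/
private theorem dduu_hook {p q r s : ℕ} {e1 : ℤ}
    (hinj : Set.InjOn ω {i | i ≤ n}) (hb : Zd.IsBridge n ω) (hirr : ∀ k, 1 ≤ k → k < n → ¬ IsWRen n ω k)
    (h6 : 6 * visits n ω = n) (hn1 : 1 ≤ n) (hrs : r < s) (hpr : p < r) (hpx : ω (p + 1) 0 = ω p 0)
    (hpy : ω (p + 1) 1 = ω p 1 - 1) (hppar : (ω (p + 1) 0 + ω (p + 1) 1) % 2 = 0) (hqx : ω (q + 1) 0 = ω q 0)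
    (hqy : ω (q + 1) 1 = ω q 1 - 1) (hqpar : (ω (q + 1) 0 + ω (q + 1) 1) % 2 = 0) (hrn : r < n)
    (hrx : ω (r + 1) 0 = ω r 0) (hrpar : (ω r 0 + ω r 1) % 2 = 0) (hsn : s < n) (hspar : (ω s 0 + ω s 1) % 2 = 0)
    (hR0 : ∀ i, i ≤ p → ω i 0 = i ∧ ω i 1 = 0) (hP1x : ω (p + 1) 0 = p) (hP1y : ω (p + 1) 1 = -1) (hpodd : p % 2 = 1)
    (hrun1 : ∀ i, p + 1 ≤ i → i ≤ q → ω i 0 = ω (p + 1) 0 + e1 * ((i - (p + 1) : ℕ) : ℤ) ∧ ω i 1 = ω (p + 1) 1)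
    (hQy : ω q 1 = -1) (hQ1y : ω (q + 1) 1 = -2) (hbev : ω q 0 % 2 = 0) (hb1 : 0 < ω q 0)
    (hrun2 : ∀ i, q + 1 ≤ i → i ≤ r → ω i 0 = ω (q + 1) 0 + 1 * ((i - (q + 1) : ℕ) : ℤ) ∧ ω i 1 = ω (q + 1) 1)
    (hRy : ω r 1 = -2) (hR1y : ω (r + 1) 1 = -1) (hcev : ω r 0 % 2 = 0)
    (hrun3 : ∀ i, r + 1 ≤ i → i ≤ s → ω i 0 = ω (r + 1) 0 + 1 * ((i - (r + 1) : ℕ) : ℤ) ∧ ω i 1 = ω (r + 1) 1)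
    (hSy : ω s 1 = -1) (hsev : s % 2 = 0) (hns : s + 2 ≤ n)
    (hR4 : ∀ j, s + 1 ≤ j → j ≤ n → ω j 0 = ω s 0 + ((j - (s + 1) : ℕ) : ℤ) ∧ ω j 1 = 0)
    (hv : visits n ω = p / 2 + (n - s) / 2) (hd : ω s 0 = p + 2) (hbq : ω q 0 = p + e1 * ((q - (p + 1) : ℕ) : ℤ))
    (hq2 : p + 2 ≤ q) (hcase : (e1 = 1 ∧ q = p + 2) ∨ (e1 = -1 ∧ q + 1 ≤ 2 * p)) (hble : ω q 0 ≤ p + 1)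
    (hrun1le : ∀ i, p + 1 ≤ i → i ≤ q → ω i 0 ≤ p + 1) (hr2 : q + 2 ≤ r)
    (hc : ω r 0 = ω q 0 + ((r - (q + 1) : ℕ) : ℤ)) (hrun2le : ∀ i, q + 1 ≤ i → i ≤ r → ω i 0 ≤ ω r 0) :
    ∃ k, 2 ≤ k ∧ n = 6 * k ∧ ∀ i, i ≤ n → ω i 0 = hookTabX k i ∧ ω i 1 = hookTabY k i := by
  classical
  have hmem : ∀ i, i ≤ n → i ∈ {i | i ≤ n} := fun i hi => hi
  have hcs : ω s 0 = ω r 0 + ((s - (r + 1) : ℕ) : ℤ) := by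
    have := (hrun3 s (by omega) le_rfl).1; rw [hrx] at this; omega
  rcases hcase with ⟨rfl, hq⟩ | ⟨rfl, hq⟩
  · -- `b = p + 1`, `c ≥ p + 2` even, `d ≥ p + 3`: contradiction
    exfalso; rw [hbq] at hc; omega
  · rw [hbq] at hc
    by_cases hcp : ω r 0 ≤ (p : ℤ) - 1
    · -- `(c, −1) = ω (r + 1)` lies on run 1
      exfalso
      have h1 := hrun1 (2 * p + 1 - (ω r 0).toNat) (by omega) (by omega)
      rw [hP1x, hP1y] at h1
      have := hinj (hmem (r + 1) (by omega)) (hmem (2 * p + 1 - (ω r 0).toNat) (by omega))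
        (site_ext_rig (by rw [hrx, h1.1]; omega) (by rw [hR1y, h1.2]))
      omega
    · -- `c = p + 1`: THE HOOK
      have hcp1 : ω r 0 = p + 1 := by omega
      have hsr : s = r + 2 := by omega
      have hnse : n = s + 2 := by
        by_contra hne
        refine hirr (s + 2) (by omega) (by omega) (isWRen_of hb (by omega) (by omega) ?_ ?_ ?_)
        · exact (hR4 (s + 2) (by omega) (by omega)).2
        · intro i h1 h2
          rw [(hR4 (s + 2) (by omega) (by omega)).1, hd]
          rcases Nat.lt_or_ge i (p + 1) with hi1 | hi1
          · have := (hR0 i (by omega)).1; omega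
          rcases Nat.lt_or_ge i (q + 1) with hi2 | hi2
          · have := hrun1le i hi1 (by omega); omega
          rcases Nat.lt_or_ge i (r + 1) with hi3 | hi3
          · have := hrun2le i hi2 (by omega); omega
          rcases Nat.lt_or_ge i (s + 1) with hi4 | hi4
          · have := (hrun3 i hi3 (by omega)).1; rw [hrx] at this; omega
          · have := (hR4 i hi4 (by omega)).1; omega
        · intro j h1 h2
          rw [(hR4 (s + 2) (by omega) (by omega)).1, (hR4 j (by omega) h2).1]; omega
      have hq' : q + 1 = 2 * p := by rw [hv] at h6; omega
      obtain ⟨k, hk⟩ : ∃ k, p + 1 = 2 * k := ⟨(p + 1) / 2, by omega⟩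
      have hr' : r + 1 = 3 * p := by omega
      refine ⟨k, by omega, by omega, hook_table hk hq' hr' hsr hnse hR0 (fun i h1 h2 => ?_) (fun i h1 h2 => ?_)
        ⟨by rw [hrx, hcp1], hR1y⟩ ⟨hd, hSy⟩ (fun j h1 h2 => ?_)⟩
      · obtain ⟨hx, hy⟩ := hrun1 i h1 h2; rw [hP1x] at hx; rw [hP1y] at hy; exact ⟨by omega, hy⟩
      · obtain ⟨hx, hy⟩ := hrun2 i h1 h2; rw [hqx, hbq] at hx; rw [hQ1y] at hy; exact ⟨by omega, hy⟩
      · obtain ⟨hx, hy⟩ := hR4 j h1 h2; rw [hd] at hx; exact ⟨by omega, hy⟩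

/-- **Profile `D D U U`, run 3 leftward, is impossible.**  Run 3 descends from a column `c ≥ p + 3` to `p + 2`; the final run
reaches column `c` again at a time `τ` which is a wall-renewal time unless `τ = n`; with `τ = n` the count `6·v = n` forces either
`b = 3` (odd: contradicting the parity of the second down step) or `p = 3` with a one-step run 1, and then `t = 2` is a
wall-renewal time. [cite: MadrasSlade1993, §4.2, Definition 4.2.1; EntingJensen2009, §7.4.2, Fig. 7.10] -/
private theorem dduu_left_false {p q r s : ℕ} {e1 : ℤ}
    (hb : Zd.IsBridge n ω) (hb' : ∀ i, 1 ≤ i → i ≤ n → 0 < ω i 0 ∧ ω i 0 ≤ ω n 0)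
    (hirr : ∀ k, 1 ≤ k → k < n → ¬ IsWRen n ω k) (h6 : 6 * visits n ω = n) (hn1 : 1 ≤ n) (hrs : r < s)
    (hpx : ω (p + 1) 0 = ω p 0) (hpy : ω (p + 1) 1 = ω p 1 - 1) (hppar : (ω (p + 1) 0 + ω (p + 1) 1) % 2 = 0)
    (hqn : q < n) (hqx : ω (q + 1) 0 = ω q 0) (hqy : ω (q + 1) 1 = ω q 1 - 1)
    (hqpar : (ω (q + 1) 0 + ω (q + 1) 1) % 2 = 0) (hrn : r < n) (hrx : ω (r + 1) 0 = ω r 0)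
    (hrpar : (ω r 0 + ω r 1) % 2 = 0) (hsn : s < n) (hspar : (ω s 0 + ω s 1) % 2 = 0)
    (hR0 : ∀ i, i ≤ p → ω i 0 = i ∧ ω i 1 = 0) (hP1x : ω (p + 1) 0 = p) (hP1y : ω (p + 1) 1 = -1) (hpodd : p % 2 = 1)
    (hrun1 : ∀ i, p + 1 ≤ i → i ≤ q → ω i 0 = ω (p + 1) 0 + e1 * ((i - (p + 1) : ℕ) : ℤ) ∧ ω i 1 = ω (p + 1) 1)
    (hQy : ω q 1 = -1) (hbev : ω q 0 % 2 = 0) (hb1 : 0 < ω q 0)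
    (hrun2 : ∀ i, q + 1 ≤ i → i ≤ r → ω i 0 = ω (q + 1) 0 + 1 * ((i - (q + 1) : ℕ) : ℤ) ∧ ω i 1 = ω (q + 1) 1)
    (hRy : ω r 1 = -2) (hcev : ω r 0 % 2 = 0)
    (hrun3 : ∀ i, r + 1 ≤ i → i ≤ s → ω i 0 = ω (r + 1) 0 + (-1) * ((i - (r + 1) : ℕ) : ℤ) ∧ ω i 1 = ω (r + 1) 1)
    (hSy : ω s 1 = -1) (hsev : s % 2 = 0)
    (hR4 : ∀ j, s + 1 ≤ j → j ≤ n → ω j 0 = ω s 0 + ((j - (s + 1) : ℕ) : ℤ) ∧ ω j 1 = 0)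
    (hv : visits n ω = p / 2 + (n - s) / 2) (hd : ω s 0 = p + 2) (hbq : ω q 0 = p + e1 * ((q - (p + 1) : ℕ) : ℤ))
    (hq2 : p + 2 ≤ q) (hcase : (e1 = 1 ∧ q = p + 2) ∨ (e1 = -1 ∧ q + 1 ≤ 2 * p)) (hble : ω q 0 ≤ p + 1)
    (hrun1le : ∀ i, p + 1 ≤ i → i ≤ q → ω i 0 ≤ p + 1) (hr2 : q + 2 ≤ r)
    (hc : ω r 0 = ω q 0 + ((r - (q + 1) : ℕ) : ℤ)) (hrun2le : ∀ i, q + 1 ≤ i → i ≤ r → ω i 0 ≤ ω r 0) :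
    False := by
  classical
  have hmem : ∀ i, i ≤ n → i ∈ {i | i ≤ n} := fun i hi => hi
  have hcs : ω s 0 = ω r 0 - ((s - (r + 1) : ℕ) : ℤ) := by
    have := (hrun3 s (by omega) le_rfl).1; rw [hrx] at this; omega
  have hrun3le : ∀ i, r + 1 ≤ i → i ≤ s → ω i 0 ≤ ω r 0 := fun i h1 h2 => by
    have := (hrun3 i h1 h2).1; rw [hrx] at this; omega
  have hrun3ge : ∀ i, r + 1 ≤ i → i ≤ s → ω s 0 ≤ ω i 0 := fun i h1 h2 => by
    have := (hrun3 i h1 h2).1; rw [hrx] at this; omega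
  obtain ⟨τ, hτ⟩ : ∃ τ : ℕ, τ = s + (ω r 0).toNat - p - 1 := ⟨_, rfl⟩
  -- `τ = n`: the bridge condition gives `τ ≤ n`, and `τ < n` would make `τ` a wall-renewal time
  have hτn : n = τ := by
    have hbn := (hb' r (by omega) (by omega)).2
    rw [(hR4 n (by omega) le_rfl).1, hd] at hbn
    by_contra hne
    have hlt : τ < n := by omega
    refine hirr τ (by omega) hlt (isWRen_of hb hlt.le (by omega) ?_ ?_ ?_)
    · exact (hR4 τ (by omega) (by omega)).2
    · intro i h1 h2
      rw [(hR4 τ (by omega) (by omega)).1, hd]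
      rcases Nat.lt_or_ge i (p + 1) with hi1 | hi1
      · have := (hR0 i (by omega)).1; omega
      rcases Nat.lt_or_ge i (q + 1) with hi2 | hi2
      · have := hrun1le i hi1 (by omega); omega
      rcases Nat.lt_or_ge i (r + 1) with hi3 | hi3
      · have := hrun2le i hi2 (by omega); omega
      rcases Nat.lt_or_ge i (s + 1) with hi4 | hi4
      · have := hrun3le i hi3 (by omega); omega
      · have := (hR4 i hi4 (by omega)).1; omega
    · intro j h1 h2
      rw [(hR4 τ (by omega) (by omega)).1, (hR4 j (by omega) h2).1]; omega
  rw [hv] at h6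
  rcases hcase with ⟨rfl, hq⟩ | ⟨rfl, hq⟩
  · -- `b = p + 1`: the counts force `p = 3`, and then `t = 2` is a wall-renewal time
    rw [hbq] at hc
    have hp3 : p = 3 := by omega
    exfalso
    refine hirr 2 (by omega) (by omega) (isWRen_of hb (by omega) (by omega) (hR0 2 (by omega)).2 ?_ ?_)
    · intro i h1 h2; rw [(hR0 2 (by omega)).1, (hR0 i (by omega)).1]; omega
    · intro j h1 h2
      rw [(hR0 2 (by omega)).1]
      rcases Nat.lt_or_ge j (p + 1) with hj1 | hj1
      · have := (hR0 j (by omega)).1; omega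
      rcases Nat.lt_or_ge j (q + 1) with hj2 | hj2
      · have := (hrun1 j hj1 (by omega)).1; rw [hP1x] at this; omega
      rcases Nat.lt_or_ge j (r + 1) with hj3 | hj3
      · have := (hrun2 j hj2 (by omega)).1; rw [hqx, hbq] at this; omega
      rcases Nat.lt_or_ge j (s + 1) with hj4 | hj4
      · have := hrun3ge j hj3 (by omega); omega
      · have := (hR4 j hj4 h2).1; omega
  · -- `b = 2p + 1 − q`: the counts force `b = 3`, contradicting the parity of the second down step
    rw [hbq] at hc hbev; omega

/-- **Profile `D D U U`.**  The runs between the vertical steps are affine (`run_affine`); the final run goes right; the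
visit count is `v = ⌊p/2⌋ + (n − s)/2` (wall run and final run), so the equality-case counts put the last up step in column
`p + 2`; run 1 is one step right or a leftward return to an even column `b ≥ 2`; run 2 goes right (else run 3 would cross
`ω q`).  The two directions of run 3 are `dduu_hook` and `dduu_left_false`.
[cite: MadrasSlade1993, §4.2, Definition 4.2.1; EntingJensen2009, §7.4.2, Fig. 7.10] -/
private theorem dduu {p q r s : ℕ}
    (hinj : Set.InjOn ω {i | i ≤ n}) (hb : Zd.IsBridge n ω) (hb' : ∀ i, 1 ≤ i → i ≤ n → 0 < ω i 0 ∧ ω i 0 ≤ ω n 0)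
    (hirr : ∀ k, 1 ≤ k → k < n → ¬ IsWRen n ω k) (hs : ω ∈ saws n) (h6 : 6 * visits n ω = n) (h3 : 3 * ω n 0 = n + 6)
    (hn1 : 1 ≤ n) (hpq : p < q) (hrs : r < s) (hpr : p < r) (hqs : q < s) (hqr : q < r) (hpn : p < n)
    (hpx : ω (p + 1) 0 = ω p 0) (hpy : ω (p + 1) 1 = ω p 1 - 1) (hppar : (ω (p + 1) 0 + ω (p + 1) 1) % 2 = 0)
    (hqn : q < n) (hqx : ω (q + 1) 0 = ω q 0) (hqy : ω (q + 1) 1 = ω q 1 - 1)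
    (hqpar : (ω (q + 1) 0 + ω (q + 1) 1) % 2 = 0) (hrn : r < n) (hrx : ω (r + 1) 0 = ω r 0)
    (hry : ω (r + 1) 1 = ω r 1 + 1) (hrpar : (ω r 0 + ω r 1) % 2 = 0) (hsn : s < n) (hsx : ω (s + 1) 0 = ω s 0)
    (hsy : ω (s + 1) 1 = ω s 1 + 1) (hspar : (ω s 0 + ω s 1) % 2 = 0)
    (hhor : ∀ i, i < n → i ≠ p → i ≠ q → i ≠ r → i ≠ s →
      ω (i + 1) 1 = ω i 1 ∧ (ω (i + 1) 0 = ω i 0 + 1 ∨ ω (i + 1) 0 = ω i 0 - 1))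
    (hR0 : ∀ i, i ≤ p → ω i 0 = i ∧ ω i 1 = 0) (hP1x : ω (p + 1) 0 = p) (hP1y : ω (p + 1) 1 = -1) (hpodd : p % 2 = 1) :
    ∃ k, 2 ≤ k ∧ n = 6 * k ∧ ∀ i, i ≤ n → ω i 0 = hookTabX k i ∧ ω i 1 = hookTabY k i := by
  classical
  have hmem : ∀ i, i ≤ n → i ∈ {i | i ≤ n} := fun i hi => hi
  obtain ⟨e1, he1, hrun1⟩ := run_affine hinj (a := p + 1) (b := q) (by omega) (by omega)
    (fun i h1 h2 => hhor i (by omega) (by omega) (by omega) (by omega) (by omega))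
  have hQy : ω q 1 = -1 := by rw [(hrun1 q (by omega) le_rfl).2, hP1y]
  have hQ1y : ω (q + 1) 1 = -2 := by rw [hqy, hQy]; rfl
  have hbev : ω q 0 % 2 = 0 := by rw [hqx, hQ1y] at hqpar; omega
  have hb1 := (hb' q (by omega) (by omega)).1
  -- run 2 on row `−2`, the first up step `(c,−2) → (c,−1)` with `c` even
  obtain ⟨e2, he2, hrun2⟩ := run_affine hinj (a := q + 1) (b := r) (by omega) (by omega)
    (fun i h1 h2 => hhor i (by omega) (by omega) (by omega) (by omega) (by omega))
  have hRy : ω r 1 = -2 := by rw [(hrun2 r (by omega) le_rfl).2, hQ1y]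
  have hR1y : ω (r + 1) 1 = -1 := by rw [hry, hRy]; rfl
  have hcev : ω r 0 % 2 = 0 := by rw [hRy] at hrpar; omega
  -- run 3 on row `−1`, the last up step `(d,−1) → (d,0)` with `d` odd at an even time `s`
  obtain ⟨e3, he3, hrun3⟩ := run_affine hinj (a := r + 1) (b := s) (by omega) (by omega)
    (fun i h1 h2 => hhor i (by omega) (by omega) (by omega) (by omega) (by omega))
  have hSy : ω s 1 = -1 := by rw [(hrun3 s (by omega) le_rfl).2, hR1y]
  have hS1y : ω (s + 1) 1 = 0 := by rw [hsy, hSy]; rfl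
  have hsev : s % 2 = 0 := by have := parity_apply hs (show s ≤ n by omega); rw [hSy] at this; omega
  have hns : s + 2 ≤ n := by omega
  -- run 4 on the wall goes right
  obtain ⟨e4, he4, hrun4⟩ := run_affine hinj (a := s + 1) (b := n) (by omega) le_rfl
    (fun i h1 h2 => hhor i (by omega) (by omega) (by omega) (by omega) (by omega))
  obtain rfl : e4 = 1 := by
    rcases he4 with h | rfl
    · exact h
    exfalso
    have hN := (hrun4 n (by omega) le_rfl).1
    have hbn := (hb' (s + 1) (by omega) (by omega)).2
    rw [hsx] at hN hbn
    omega
  have hR4 : ∀ j, s + 1 ≤ j → j ≤ n → ω j 0 = ω s 0 + ((j - (s + 1) : ℕ) : ℤ) ∧ ω j 1 = 0 := fun j h1 h2 => by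
    obtain ⟨hx, hy⟩ := hrun4 j h1 h2
    rw [hsx] at hx; rw [hS1y] at hy
    exact ⟨by rw [hx]; ring, hy⟩
  -- the visit count: `v = ⌊p/2⌋ + (n − s)/2`
  have hv : visits n ω = p / 2 + (n - s) / 2 := by
    have hv1 : visits p ω = p / 2 := visits_eq_div_two (fun i _ h2 => (hR0 i h2).2)
    have hv2 : visits s ω = visits p ω := by
      have := visits_add_eq_left (k := p) (b := s - p) (ζ := ω) (fun j hj1 hj2 => ?_)
      · rwa [show p + (s - p) = s by omega] at this
      rintro ⟨-, hy⟩
      rcases Nat.lt_or_ge (p + j) (q + 1) with hj | hj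
      · have := (hrun1 (p + j) (by omega) (by omega)).2; rw [hP1y] at this; omega
      rcases Nat.lt_or_ge (p + j) (r + 1) with hj' | hj'
      · have := (hrun2 (p + j) hj (by omega)).2; rw [hQ1y] at this; omega
      · have := (hrun3 (p + j) hj' (by omega)).2; rw [hR1y] at this; omega
    have hv3 : visits n ω = visits s ω + visits (n - s) (fun _ => (0 : Site 2)) := by
      have := visits_add (a := s) (b := n - s) (ζ := ω) (ξ := fun _ => (0 : Site 2)) hsev (fun j hj1 hj2 => ?_)
      · rwa [show s + (n - s) = n by omega] at this
      rw [(hR4 (s + j) (by omega) (by omega)).2]; rfl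
    have hv4 : visits (n - s) (fun _ => (0 : Site 2)) = (n - s) / 2 := visits_eq_div_two (fun i _ _ => rfl)
    rw [hv3, hv2, hv1, hv4]
  -- the equality-case counts put the last up step in column `d = p + 2`
  have hd : ω s 0 = p + 2 := by
    have hN := (hR4 n (by omega) le_rfl).1
    rw [hv] at h6
    rw [hN] at h3
    omega
  -- run 1: either one step right (`q = p + 2`, `b = p + 1`) or leftward to `b = 2p + 1 − q ≥ 2`
  have hbq : ω q 0 = p + e1 * ((q - (p + 1) : ℕ) : ℤ) := by rw [(hrun1 q (by omega) le_rfl).1, hP1x]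
  have hq2 : p + 2 ≤ q := by
    by_contra h
    obtain rfl : q = p + 1 := by omega
    rw [hqx, hP1x] at hqpar; rw [hQ1y] at hqpar; omega
  have hcase : (e1 = 1 ∧ q = p + 2) ∨ (e1 = -1 ∧ q + 1 ≤ 2 * p) := by
    rcases he1 with rfl | rfl
    · refine Or.inl ⟨rfl, ?_⟩
      by_contra hne
      -- `q ≥ p + 3`: run 1 passes `(p + 2, −1) = ω s`
      have h1 := hrun1 (p + 3) (by omega) (by omega)
      rw [hP1x, hP1y] at h1
      have := hinj (hmem (p + 3) (by omega)) (hmem s (by omega))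
        (site_ext_rig (by rw [h1.1, hd]; omega) (by rw [h1.2, hSy]))
      omega
    · refine Or.inr ⟨rfl, ?_⟩
      rw [hbq] at hb1 hbev; omega
  have hble : ω q 0 ≤ p + 1 := by
    rcases hcase with ⟨h, hq⟩ | ⟨h, hq⟩ <;> (rw [h] at hbq; rw [hbq]; omega)
  have hrun1le : ∀ i, p + 1 ≤ i → i ≤ q → ω i 0 ≤ p + 1 := fun i h1 h2 => by
    have := (hrun1 i h1 h2).1; rw [hP1x] at this
    rcases hcase with ⟨h, hq⟩ | ⟨h, hq⟩ <;> (rw [h] at this; omega)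
  -- run 2 goes right with at least one horizontal step
  have hr2 : q + 2 ≤ r := by
    by_contra h
    obtain rfl : r = q + 1 := by omega
    have := hinj (hmem (q + 1 + 1) (by omega)) (hmem q (by omega)) (site_ext_rig (by rw [hrx, hqx]) (by rw [hR1y, hQy]))
    omega
  obtain rfl : e2 = 1 := by
    rcases he2 with h | rfl
    · exact h
    exfalso
    have hc := (hrun2 r (by omega) le_rfl).1
    rw [hqx] at hc
    -- run 3 would have to climb from column `c < b` back to column `p + 2 > b` through `(b, −1) = ω q`
    rcases he3 with rfl | rfl
    · have hds := (hrun3 s (by omega) le_rfl).1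
      rw [hrx, hd] at hds
      have h1 := hrun3 (2 * r - q) (by omega) (by omega)
      rw [hrx, hR1y] at h1
      have := hinj (hmem (2 * r - q) (by omega)) (hmem q (by omega))
        (site_ext_rig (by rw [h1.1, hc]; omega) (by rw [h1.2, hQy]))
      omega
    · have := (hrun3 s (by omega) le_rfl).1; rw [hrx, hc, hd] at this; omega
  have hc : ω r 0 = ω q 0 + ((r - (q + 1) : ℕ) : ℤ) := by
    have := (hrun2 r (by omega) le_rfl).1; rw [hqx] at this; omega
  have hrun2le : ∀ i, q + 1 ≤ i → i ≤ r → ω i 0 ≤ ω r 0 := fun i h1 h2 => by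
    have := (hrun2 i h1 h2).1; rw [hqx] at this; omega
  rcases he3 with rfl | rfl
  · exact dduu_hook hinj hb hirr h6 hn1 hrs hpr hpx hpy hppar hqx hqy hqpar hrn hrx hrpar hsn hspar hR0 hP1x hP1y hpodd hrun1 hQy hQ1y hbev hb1 hrun2 hRy hR1y hcev hrun3 hSy hsev hns hR4 hv hd hbq hq2 hcase hble hrun1le hr2 hc hrun2le
  · exact (dduu_left_false hb hb' hirr h6 hn1 hrs hpx hpy hppar hqn hqx hqy hqpar hrn hrx hrpar hsn hspar hR0 hP1x hP1y hpodd hrun1 hQy hbev hb1 hrun2 hRy hcev hrun3 hSy hsev hR4 hv hd hbq hq2 hcase hble hrun1le hr2 hc hrun2le).elim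

/-- **Two down steps.**  With `#down = #up = 2` the heights are `Y_t = [r<t] + [s<t] − [p<t] − [q<t]` for the down
times `p < q` and up times `r < s`, whence `p < r` and `q < s`.  The interleaving `D U D U` forces five rightward runs and
then the second wall site of the middle wall run is a wall-renewal time; the nesting `D D U U` with the equality-case
counts `6·v = n`, `3·X_n = n + 6` (so that the last up step is in column `p + 2`) forces, run by run, the hook staircase
`H_{(p+1)/2}` — every other branch either revisits a site, produces a wall-renewal time, or contradicts a bond parity.
[cite: MadrasSlade1993, §4.2, Definition 4.2.1; EntingJensen2009, §7.4.2, Fig. 7.10] -/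
private theorem profile_two (hω : ω ∈ ipwb n) (h6 : 6 * visits n ω = n) (h3 : 3 * ω n 0 = n + 6)
    (hD : #(stepsD n ω) = 2) (hU : #(stepsU n ω) = 2) :
    ∃ k, 2 ≤ k ∧ n = 6 * k ∧ ∀ i, i ≤ n → ω i 0 = hookTabX k i ∧ ω i 1 = hookTabY k i := by
  classical
  obtain ⟨hp, hn1, hirr⟩ := mem_ipwb.1 hω
  obtain ⟨hw, hb⟩ := mem_pwb.1 hp
  obtain ⟨ha, -⟩ := mem_wbr.1 hw
  obtain ⟨hh, hn2, -⟩ := mem_archs.1 ha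
  obtain ⟨hs, hhp⟩ := mem_hpw.1 hh
  obtain ⟨h0, -, hbw, hinj⟩ := mem_saws_iff.1 hs
  have hX0 : ω 0 0 = 0 := by rw [h0]; rfl
  have hY0 : ω 0 1 = 0 := by rw [h0]; rfl
  have hb' : ∀ i, 1 ≤ i → i ≤ n → 0 < ω i 0 ∧ ω i 0 ≤ ω n 0 := fun i h1 h2 => by
    have := hb i h1 h2; rwa [hX0] at this
  have hmem : ∀ i, i ≤ n → i ∈ {i | i ≤ n} := fun i hi => hi
  -- the ordered down times `p < q` and up times `r < s`
  obtain ⟨p, q, hpq, hDpq⟩ : ∃ p q, p < q ∧ stepsD n ω = {p, q} := by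
    obtain ⟨x, y, hxy, h⟩ := Finset.card_eq_two.1 hD
    rcases lt_or_gt_of_ne hxy with hlt | hlt
    · exact ⟨x, y, hlt, h⟩
    · exact ⟨y, x, hlt, by rw [h, Finset.pair_comm]⟩
  obtain ⟨r, s, hrs, hUrs⟩ : ∃ r s, r < s ∧ stepsU n ω = {r, s} := by
    obtain ⟨x, y, hxy, h⟩ := Finset.card_eq_two.1 hU
    rcases lt_or_gt_of_ne hxy with hlt | hlt
    · exact ⟨x, y, hlt, h⟩
    · exact ⟨y, x, hlt, by rw [h, Finset.pair_comm]⟩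
  obtain ⟨hpn, hpx, hpy, hppar⟩ := of_mem_stepsD hbw (i := p) (by rw [hDpq]; simp)
  obtain ⟨hqn, hqx, hqy, hqpar⟩ := of_mem_stepsD hbw (i := q) (by rw [hDpq]; simp)
  obtain ⟨hrn, hrx, hry, hrpar⟩ := of_mem_stepsU hbw (i := r) (by rw [hUrs]; simp)
  obtain ⟨hsn, hsx, hsy, hspar⟩ := of_mem_stepsU hbw (i := s) (by rw [hUrs]; simp)
  have hhor : ∀ i, i < n → i ≠ p → i ≠ q → i ≠ r → i ≠ s →
      ω (i + 1) 1 = ω i 1 ∧ (ω (i + 1) 0 = ω i 0 + 1 ∨ ω (i + 1) 0 = ω i 0 - 1) := fun i hi hip hiq hir his =>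
    horizontal_of_not_mem hbw hi
      (by rw [hUrs]; simp only [Finset.mem_insert, Finset.mem_singleton, not_or]; exact ⟨hir, his⟩)
      (by rw [hDpq]; simp only [Finset.mem_insert, Finset.mem_singleton, not_or]; exact ⟨hip, hiq⟩)
  have hYt : ∀ t, t ≤ n → ω t 1 = ((if r < t then 1 else 0) + (if s < t then 1 else 0)) -
      ((if p < t then 1 else 0) + (if q < t then 1 else 0)) := fun t ht => by
    rw [apply_one_eq_card_sub hbw hY0 ht, hUrs, hDpq, card_filter_pair_lt (ne_of_lt hrs), card_filter_pair_lt (ne_of_lt hpq)]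
  have hpr' : p ≠ r := fun h => by rw [h] at hpy; omega
  have hps' : p ≠ s := fun h => by rw [h] at hpy; omega
  have hqr' : q ≠ r := fun h => by rw [h] at hqy; omega
  have hqs' : q ≠ s := fun h => by rw [h] at hqy; omega
  have hpr : p < r := by
    have h1 := hYt (r + 1) (by omega); have h2 := hhp (r + 1) (by omega)
    split_ifs at h1 <;> omega
  have hqs : q < s := by
    have h1 := hYt (s + 1) (by omega); have h2 := hhp (s + 1) (by omega)
    split_ifs at h1 <;> omega
  -- run 0: the wall run
  have h10 := first_step hbw hn1 hX0 hY0 hb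
  have hp1 : 1 ≤ p := by
    by_contra h
    obtain rfl : p = 0 := by omega
    norm_num at hpx
    have := (hb' 1 le_rfl hn1).1
    omega
  obtain ⟨e0, he0, hrun0⟩ := run_affine hinj (a := 0) (b := p) (by omega) (by omega)
    (fun i h1 h2 => hhor i (by omega) (by omega) (by omega) (by omega) (by omega))
  obtain rfl : e0 = 1 := by
    have := (hrun0 1 (by omega) hp1).1
    rcases he0 with rfl | rfl <;> omega
  have hR0 : ∀ i, i ≤ p → ω i 0 = i ∧ ω i 1 = 0 := fun i hi => by
    obtain ⟨h1, h2⟩ := hrun0 i (Nat.zero_le _) hi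
    rw [hX0] at h1; rw [hY0] at h2
    exact ⟨by omega, h2⟩
  have hP1x : ω (p + 1) 0 = p := by rw [hpx, (hR0 p le_rfl).1]
  have hP1y : ω (p + 1) 1 = -1 := by rw [hpy, (hR0 p le_rfl).2]; rfl
  have hpodd : p % 2 = 1 := by rw [hP1x, hP1y] at hppar; omega
  rcases lt_or_gt_of_ne hqr' with hqr | hrq
  · exact dduu hinj hb hb' hirr hs h6 h3 hn1 hpq hrs hpr hqs hqr hpn hpx hpy hppar hqn hqx hqy hqpar hrn hrx hry hrpar hsn hsx hsy hspar hhor hR0 hP1x hP1y hpodd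
  · exact (dudu_false hinj hb hb' hirr h6 h3 hn1 hpq hrs hpr hqs hrq hpn hpx hpy hppar hqn hqx hqy hqpar hrn hrx hry hrpar hsn hsx hsy hspar hhor hR0 hP1x hP1y hpodd).elim


/-! ### §6  The hook staircases are irreducible blocks attaining `6·v = n` -/

/-- The Boolean adjacency test of `Eight` read as a proposition. [cite: EntingJensen2009, §7.4.2, Fig. 7.10 (brickwork form of the honeycomb lattice)] -/
private theorem adjE_eq_true_iff {a b c d : ℤ} : Eight.adjE a b c d = true ↔
    ((c = a + 1 ∨ a = c + 1) ∧ d = b) ∨ (c = a ∧ ((d = b + 1 ∧ (a + b) % 2 = 0) ∨ (b = d + 1 ∧ (c + d) % 2 = 0))) := by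
  simp [Eight.adjE]

/-- Values of the hook tables on the initial wall run `[0, 2k − 1]`. [cite: EntingJensen2009, §7.4.2, Fig. 7.10] -/
private theorem hook_v1 {k i : ℕ} (h : i + 1 ≤ 2 * k) : hookTabX k i = i ∧ hookTabY k i = 0 := by
  constructor <;> simp only [hookTabX, hookTabY] <;> split_ifs <;> omega

/-- Values on the leftward run of row `−1`, times `[2k, 4k − 3]`. [cite: EntingJensen2009, §7.4.2, Fig. 7.10] -/
private theorem hook_v2 {k i : ℕ} (h1 : 2 * k ≤ i) (h2 : i + 3 ≤ 4 * k) :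
    hookTabX k i = 4 * (k : ℤ) - 1 - i ∧ hookTabY k i = -1 := by
  constructor <;> simp only [hookTabX, hookTabY] <;> split_ifs <;> omega

/-- Values on the rightward run of row `−2`, times `[4k − 2, 6k − 4]`. [cite: EntingJensen2009, §7.4.2, Fig. 7.10] -/
private theorem hook_v3 {k i : ℕ} (h1 : 4 * k ≤ i + 2) (h2 : i + 4 ≤ 6 * k) :
    hookTabX k i = (i : ℤ) + 4 - 4 * k ∧ hookTabY k i = -2 := by
  constructor <;> simp only [hookTabX, hookTabY] <;> split_ifs <;> omega

/-- Value at time `6k − 3`. [cite: EntingJensen2009, §7.4.2, Fig. 7.10] -/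
private theorem hook_v4 {k i : ℕ} (h : i + 3 = 6 * k) : hookTabX k i = 2 * (k : ℤ) ∧ hookTabY k i = -1 := by
  constructor <;> simp only [hookTabX, hookTabY] <;> split_ifs <;> omega

/-- Value at time `6k − 2`. [cite: EntingJensen2009, §7.4.2, Fig. 7.10] -/
private theorem hook_v5 {k i : ℕ} (h : i + 2 = 6 * k) : hookTabX k i = 2 * (k : ℤ) + 1 ∧ hookTabY k i = -1 := by
  constructor <;> simp only [hookTabX, hookTabY] <;> split_ifs <;> omega

/-- Value at time `6k − 1`. [cite: EntingJensen2009, §7.4.2, Fig. 7.10] -/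
private theorem hook_v6 {k i : ℕ} (h : i + 1 = 6 * k) : hookTabX k i = 2 * (k : ℤ) + 1 ∧ hookTabY k i = 0 := by
  constructor <;> simp only [hookTabX, hookTabY] <;> split_ifs <;> omega

/-- Value at the endpoint `6k` (and the frozen value after it). [cite: EntingJensen2009, §7.4.2, Fig. 7.10] -/
private theorem hook_v7 {k i : ℕ} (h : 6 * k ≤ i) : hookTabX k i = 2 * (k : ℤ) + 2 ∧ hookTabY k i = 0 := by
  constructor <;> simp only [hookTabX, hookTabY] <;> split_ifs <;> omega

/-- The seven affine pieces of the hook tables, with their values. [cite: EntingJensen2009, §7.4.2, Fig. 7.10] -/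
private theorem hook_cases {k i : ℕ} (hi : i ≤ 6 * k) :
    (i + 1 ≤ 2 * k ∧ hookTabX k i = i ∧ hookTabY k i = 0) ∨
      (2 * k ≤ i ∧ i + 3 ≤ 4 * k ∧ hookTabX k i = 4 * (k : ℤ) - 1 - i ∧ hookTabY k i = -1) ∨
      (4 * k ≤ i + 2 ∧ i + 4 ≤ 6 * k ∧ hookTabX k i = (i : ℤ) + 4 - 4 * k ∧ hookTabY k i = -2) ∨
      (i + 3 = 6 * k ∧ hookTabX k i = 2 * (k : ℤ) ∧ hookTabY k i = -1) ∨
      (i + 2 = 6 * k ∧ hookTabX k i = 2 * (k : ℤ) + 1 ∧ hookTabY k i = -1) ∨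
      (i + 1 = 6 * k ∧ hookTabX k i = 2 * (k : ℤ) + 1 ∧ hookTabY k i = 0) ∨
      (i = 6 * k ∧ hookTabX k i = 2 * (k : ℤ) + 2 ∧ hookTabY k i = 0) := by
  have hreg : i + 1 ≤ 2 * k ∨ (2 * k ≤ i ∧ i + 3 ≤ 4 * k) ∨ (4 * k ≤ i + 2 ∧ i + 4 ≤ 6 * k) ∨ i + 3 = 6 * k ∨
      i + 2 = 6 * k ∨ i + 1 = 6 * k ∨ i = 6 * k := by omega
  rcases hreg with a | ⟨a, b⟩ | ⟨a, b⟩ | a | a | a | a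
  · exact Or.inl ⟨a, hook_v1 a⟩
  · exact Or.inr (Or.inl ⟨a, b, hook_v2 a b⟩)
  · exact Or.inr (Or.inr (Or.inl ⟨a, b, hook_v3 a b⟩))
  · exact Or.inr (Or.inr (Or.inr (Or.inl ⟨a, hook_v4 a⟩)))
  · exact Or.inr (Or.inr (Or.inr (Or.inr (Or.inl ⟨a, hook_v5 a⟩))))
  · exact Or.inr (Or.inr (Or.inr (Or.inr (Or.inr (Or.inl ⟨a, hook_v6 a⟩)))))
  · exact Or.inr (Or.inr (Or.inr (Or.inr (Or.inr (Or.inr ⟨a, hook_v7 a.ge⟩)))))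

/-- **Coordinate facts of the hook staircase** `H_k` (`k ≥ 2`): consecutive sites are brick-wall neighbours, the sites are
distinct, they lie in the lower half-plane, the columns lie in `[0, 2k + 2]` and are `≥ 1` after time `0`, the walk starts and
ends on the boundary row, and the length `6k` is even.  All clauses by case analysis on the seven affine pieces of the tables.
[cite: EntingJensen2009, §7.4.2, Fig. 7.10] [cite: MadrasSlade1993, §1.2, Definition 1.2.1 (bridges)] -/
theorem hook_facts {k : ℕ} (hk : 2 ≤ k) : Tab.Facts (6 * k) (hookTabX k) (hookTabY k) := by
  refine ⟨fun i hi => ?_, fun i hi j hj hx hy => ?_, fun i hi => ?_, fun i hi => ?_, ?_, ?_, ?_, by omega, fun i hi h1 => ?_⟩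
  · rw [adjE_eq_true_iff]
    rcases hook_cases (k := k) (i := i) hi.le with ⟨a, x, y⟩ | ⟨a, b, x, y⟩ | ⟨a, b, x, y⟩ | ⟨a, x, y⟩ | ⟨a, x, y⟩ |
        ⟨a, x, y⟩ | ⟨a, x, y⟩ <;>
      rcases hook_cases (k := k) (i := i + 1) (by omega) with ⟨a', x', y'⟩ | ⟨a', b', x', y'⟩ | ⟨a', b', x', y'⟩ |
          ⟨a', x', y'⟩ | ⟨a', x', y'⟩ | ⟨a', x', y'⟩ | ⟨a', x', y'⟩ <;>
      omega
  · rcases hook_cases (k := k) (i := i) hi with ⟨a, x, y⟩ | ⟨a, b, x, y⟩ | ⟨a, b, x, y⟩ | ⟨a, x, y⟩ | ⟨a, x, y⟩ |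
        ⟨a, x, y⟩ | ⟨a, x, y⟩ <;>
      rcases hook_cases (k := k) (i := j) hj with ⟨a', x', y'⟩ | ⟨a', b', x', y'⟩ | ⟨a', b', x', y'⟩ | ⟨a', x', y'⟩ |
          ⟨a', x', y'⟩ | ⟨a', x', y'⟩ | ⟨a', x', y'⟩ <;>
      omega
  · rcases hook_cases (k := k) (i := i) hi with ⟨a, x, y⟩ | ⟨a, b, x, y⟩ | ⟨a, b, x, y⟩ | ⟨a, x, y⟩ | ⟨a, x, y⟩ |
        ⟨a, x, y⟩ | ⟨a, x, y⟩ <;> omega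
  · have h0 := (hook_v1 (k := k) (i := 0) (by omega)).1
    have hL := (hook_v7 (k := k) (i := 6 * k) le_rfl).1
    rcases hook_cases (k := k) (i := i) hi with ⟨a, x, y⟩ | ⟨a, b, x, y⟩ | ⟨a, b, x, y⟩ | ⟨a, x, y⟩ | ⟨a, x, y⟩ |
        ⟨a, x, y⟩ | ⟨a, x, y⟩ <;> omega
  · have h0 := (hook_v1 (k := k) (i := 0) (by omega)).1; omega
  · exact (hook_v1 (k := k) (i := 0) (by omega)).2
  · exact (hook_v7 (k := k) (i := 6 * k) le_rfl).2
  · rcases hook_cases (k := k) (i := i) hi with ⟨a, x, y⟩ | ⟨a, b, x, y⟩ | ⟨a, b, x, y⟩ | ⟨a, x, y⟩ | ⟨a, x, y⟩ |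
        ⟨a, x, y⟩ | ⟨a, x, y⟩ <;> omega

/-- The hook staircase `H_k` (`k ≥ 2`) is a positive wall bridge of length `m = 6k` (length symbolic).
[cite: MadrasSlade1993, §1.2, Definition 1.2.4] [cite: EntingJensen2009, §7.4.2, Fig. 7.10] -/
theorem hook_mem_pwb {k m : ℕ} (hk : 2 ≤ k) (hm : m = 6 * k) : hook k ∈ pwb m :=
  mem_pwb_of_facts rfl (hook_facts hk) hm

/-- Coordinates of the hook staircase up to its length. [cite: EntingJensen2009, §7.4.2, Fig. 7.10] -/
theorem hook_apply {k i : ℕ} (hi : i ≤ 6 * k) : hook k i 0 = hookTabX k i ∧ hook k i 1 = hookTabY k i := by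
  simp only [hook]; rw [Tab.walk_apply_of_le hi, Arm.pt_apply_zero, Arm.pt_apply_one]; exact ⟨rfl, rfl⟩

/-- **The hook staircase is irreducible**: `H_k ∈ ipwb (6k)` for `k ≥ 2`.  Its interior wall visits are at the even times
`t ≤ 2k − 2` of the initial wall run, and none of them is a wall-renewal time, because the excursion returns to column `2 ≤ t`
at time `4k − 3 > t` (so the piece after `t` is not a bridge).
[cite: MadrasSlade1993, §4.2, Definition 4.2.1] [cite: Kesten1963SAW, §4] [cite: EntingJensen2009, §7.4.2, Fig. 7.10] -/
theorem hook_mem_ipwb {k m : ℕ} (hk : 2 ≤ k) (hm : m = 6 * k) : hook k ∈ ipwb m := by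
  rw [mem_ipwb]
  refine ⟨hook_mem_pwb hk hm, by omega, fun t ht1 ht2 hren => ?_⟩
  obtain ⟨⟨-, -, htail⟩, hte, hY⟩ := hren
  subst hm
  rw [(hook_apply ht2.le).2] at hY
  have ht : t + 1 ≤ 2 * k := by
    rcases hook_cases (k := k) (i := t) ht2.le with ⟨a, x, y⟩ | ⟨a, b, x, y⟩ | ⟨a, b, x, y⟩ | ⟨a, x, y⟩ | ⟨a, x, y⟩ |
        ⟨a, x, y⟩ | ⟨a, x, y⟩ <;> omega
  have h := (htail (4 * k - 3 - t) (by omega) (by omega)).1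
  simp only [Nat.add_zero] at h
  rw [show t + (4 * k - 3 - t) = 4 * k - 3 by omega, (hook_apply (by omega : t ≤ 6 * k)).1,
    (hook_apply (by omega : 4 * k - 3 ≤ 6 * k)).1, (hook_v1 ht).1,
    (hook_v2 (k := k) (i := 4 * k - 3) (by omega) (by omega)).1] at h
  omega

/-- **The hook staircase has `k` wall visits**: `v(H_k) = k` with `|H_k| = 6k`, so `H_k` attains equality in the six-step law
`6·v ≤ n` (the visits are at the even times `2, …, 2k − 2` of the wall run and at the endpoint `6k`).
[cite: MadrasSlade1993, §4.2, remark before (4.2.21) (p. 94)] [cite: EntingJensen2009, §7.4.2, Fig. 7.10] -/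
theorem visits_hook {k m : ℕ} (hk : 2 ≤ k) (hm : m = 6 * k) : visits m (hook k) = k := by
  have hY : ∀ i, i ≤ 6 * k → hook k i 1 = hookTabY k i := fun i hi => (hook_apply hi).2
  have h1 : visits (2 * k - 1) (hook k) = (2 * k - 1) / 2 :=
    visits_eq_div_two fun i _ hi => by rw [hY i (by omega)]; exact (hook_v1 (by omega)).2
  have h2 : visits (2 * k - 1 + (4 * k - 1)) (hook k) = visits (2 * k - 1) (hook k) :=
    visits_add_eq_left fun j hj1 hj2 h => by
      obtain ⟨he, h0⟩ := h
      rw [hY _ (by omega)] at h0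
      rcases hook_cases (k := k) (i := 2 * k - 1 + j) (by omega) with ⟨a, x, y⟩ | ⟨a, b, x, y⟩ | ⟨a, b, x, y⟩ |
          ⟨a, x, y⟩ | ⟨a, x, y⟩ | ⟨a, x, y⟩ | ⟨a, x, y⟩ <;> omega
  have h3 := visits_succ (6 * k - 2) (hook k)
  have h4 := visits_succ (6 * k - 1) (hook k)
  rw [show 6 * k - 2 + 1 = 6 * k - 1 by omega] at h3
  rw [show 6 * k - 1 + 1 = 6 * k by omega, h3, show 6 * k - 2 = 2 * k - 1 + (4 * k - 1) by omega, h2, h1] at h4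
  have h5 : hook k (6 * k) 1 = 0 := by rw [hY _ le_rfl]; exact (hook_v7 le_rfl).2
  rw [if_neg (by omega), if_pos ⟨by omega, h5⟩] at h4
  subst hm
  rw [h4]; omega

/-! ### §7  Rigidity: the equality case of the six-step law -/

/-- **Rigidity of the six-step law (equality case).**  An irreducible positive wall bridge of length `n ≥ 4` with `6·v(ω) = n`
is the dip excursion (`n = 6`, `v = 1`) or a hook staircase `H_k` (`n = 6k`, `v = k`, `k ≥ 2`):
`(0,0) → … → (2k−1,0) ↓ (2k−1,−1) ← … ← (2,−1) ↓ (2,−2) → … → (2k,−2) ↑ (2k,−1) → (2k+1,−1) ↑ (2k+1,0) → (2k+2,0)`.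
Proof: by the slack identities of the six-step law, equality forces `X_n = 2v + 2` and at most two down steps; one down step
forces `n = 6` (`eq_six_of_card_stepsD_eq_one`, and `ipwb 6 = {dip}`); two down steps force the `D D U U` profile with every run
of extremal length, i.e. the hook (`profile_two`).  OURS (the printed sources carry the renewal structure and the series data, not
this classification). [cite: MadrasSlade1993, §4.2, remark before (4.2.21) (p. 94); §1.2, Definition 1.2.4]
[cite: EntingJensen2009, §7.4.2, Fig. 7.10] -/
theorem eq_hook_of_six_mul_visits_eq (hω : ω ∈ ipwb n) (hn : 4 ≤ n) (h6 : 6 * visits n ω = n) :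
    (n = 6 ∧ ω = Six.dw) ∨ ∃ k, 2 ≤ k ∧ n = 6 * k ∧ ω = hook k := by
  obtain ⟨h3, hD2, hD1, hUD⟩ := eq_case_counts hω hn h6
  rcases Nat.lt_or_ge #(stepsD n ω) 2 with hlt | hge
  · have hD : #(stepsD n ω) = 1 := by omega
    have hn6 : n = 6 := eq_six_of_card_stepsD_eq_one hω h3 hD (by rw [hUD, hD])
    have h := hω
    rw [ipwb_six_eq_singleton hn6, Finset.mem_singleton] at h
    exact Or.inl ⟨hn6, h⟩
  · have hD : #(stepsD n ω) = 2 := by omega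
    obtain ⟨k, hk, hnk, htab⟩ := profile_two hω h6 h3 hD (by rw [hUD, hD])
    refine Or.inr ⟨k, hk, hnk, funext fun i => ?_⟩
    obtain ⟨hp, -, -⟩ := mem_ipwb.1 hω
    obtain ⟨hw, -⟩ := mem_pwb.1 hp
    obtain ⟨ha, -⟩ := mem_wbr.1 hw
    obtain ⟨hh, -, -⟩ := mem_archs.1 ha
    obtain ⟨hs, -⟩ := mem_hpw.1 hh
    obtain ⟨-, hend, -, -⟩ := mem_saws_iff.1 hs
    subst hnk
    rcases le_or_gt i (6 * k) with hi | hi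
    · obtain ⟨hx, hy⟩ := htab i hi
      obtain ⟨hx', hy'⟩ := hook_apply (k := k) hi
      exact site_ext_rig (by rw [hx, hx']) (by rw [hy, hy'])
    · obtain ⟨hx, hy⟩ := htab (6 * k) le_rfl
      obtain ⟨hx', hy'⟩ := hook_apply (k := k) (le_refl (6 * k))
      have hfr : hook k i = hook k (6 * k) := by simp only [hook, Tab.walk, min_eq_right hi.le, min_self]
      rw [hend i hi.le, hfr]
      exact site_ext_rig (by rw [hx, hx']) (by rw [hy, hy'])

/-- **The equality case of the six-step law as an equivalence**: for an irreducible positive wall bridge of length `n ≥ 4`,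
`6·v(ω) = n` iff `ω` is the dip excursion (`n = 6`) or a hook staircase `H_k` (`n = 6k`, `k ≥ 2`). OURS.
[cite: MadrasSlade1993, §4.2, remark before (4.2.21) (p. 94)] [cite: EntingJensen2009, §7.4.2, Fig. 7.10] -/
theorem six_mul_visits_eq_iff (hω : ω ∈ ipwb n) (hn : 4 ≤ n) :
    6 * visits n ω = n ↔ (n = 6 ∧ ω = Six.dw) ∨ ∃ k, 2 ≤ k ∧ n = 6 * k ∧ ω = hook k := by
  refine ⟨eq_hook_of_six_mul_visits_eq hω hn, ?_⟩
  rintro (⟨hn6, rfl⟩ | ⟨k, hk, hnk, rfl⟩)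
  · rw [visits_eq_one_of_mem_ipwb_six hn6 (dw_mem_ipwb hn6)]; omega
  · rw [visits_hook hk hnk]; omega

/-- **`N_{3k,k} = 1` (`k ≥ 2`).**  The hook staircase is the unique irreducible positive wall bridge of length `m = 6k` with `k`
wall visits (length symbolic). OURS. [cite: MadrasSlade1993, §4.2, remark before (4.2.21) (p. 94)] [cite: EntingJensen2009, §7.4.2, Fig. 7.10] -/
theorem filter_six_mul_visits_eq_singleton_hook {k m : ℕ} (hk : 2 ≤ k) (hm : m = 6 * k) :
    (ipwb m).filter (fun ω => 6 * visits m ω = m) = {hook k} := by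
  ext ζ
  simp only [Finset.mem_filter, Finset.mem_singleton]
  constructor
  · rintro ⟨hζ, h6⟩
    rcases eq_hook_of_six_mul_visits_eq hζ (by omega) h6 with ⟨h, -⟩ | ⟨k', -, hk'n, rfl⟩
    · omega
    · rw [show k' = k by omega]
  · rintro rfl
    exact ⟨hook_mem_ipwb hk hm, by rw [visits_hook hk hm, hm]⟩

/-- **`N_{3,1} = 1`.**  The dip excursion is the unique irreducible positive wall bridge of length `m = 6` with one wall visit
(length symbolic). [cite: MadrasSlade1993, §4.2, Definition 4.2.1] [cite: EntingJensen2009, §7.4.2, Fig. 7.10] -/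
theorem filter_six_mul_visits_eq_singleton_dw {m : ℕ} (hm : m = 6) :
    (ipwb m).filter (fun ω => 6 * visits m ω = m) = {Six.dw} := by
  ext ζ
  simp only [Finset.mem_filter, Finset.mem_singleton]
  constructor
  · rintro ⟨hζ, -⟩
    rwa [ipwb_six_eq_singleton hm, Finset.mem_singleton] at hζ
  · rintro rfl
    exact ⟨dw_mem_ipwb hm, by rw [visits_eq_one_of_mem_ipwb_six hm (dw_mem_ipwb hm), hm]⟩

/-- **Census of the equality case.**  For every length `n ≥ 1`, the irreducible positive wall bridges with `6·v = n` number
exactly one if `6 ∣ n` (the dip for `n = 6`, the hook `H_{n/6}` otherwise) and zero if not. OURS.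
[cite: MadrasSlade1993, §4.2, remark before (4.2.21) (p. 94)] [cite: EntingJensen2009, §7.4.2, Fig. 7.10] -/
theorem card_filter_six_mul_visits_eq (hn : 1 ≤ n) :
    #((ipwb n).filter fun ω => 6 * visits n ω = n) = if 6 ∣ n then 1 else 0 := by
  split_ifs with h
  · obtain ⟨k, hk⟩ := h
    rcases Nat.lt_or_ge k 2 with hk2 | hk2
    · rw [filter_six_mul_visits_eq_singleton_dw (show n = 6 by omega), Finset.card_singleton]
    · rw [filter_six_mul_visits_eq_singleton_hook hk2 hk, Finset.card_singleton]
  · rw [Finset.card_eq_zero, Finset.filter_eq_empty_iff]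
    intro ζ _ h6
    exact h ⟨visits n ζ, by omega⟩


end Literature.Probability.RandomPlanarGeometry.SAW.HexBW.Wall
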